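import Mathlib
import Literature.MathematicalPhysics.QuantumLattice.HubbardBandSectorCountingToolbox
import HarnessLib

/-!
# Four-sector counting on the band Fermi curve: the grid counts

Topic `Literature/MathematicalPhysics/QuantumLattice`; sub-namespace `BandSectorCounting`; continues
`HubbardBandSectorCountingToolbox.lean`. With `w` the grid spacing (`N w = 2π`), `θ_i = w/2 + i w`, and the level
function `h` of three curve points, the number of grid pairs `(a, c)` with `|h(θ_a, θ_c)| ≤ C_δ w` is
`≤ K_p (J + 2 + log N)/w` (`2^J w = π`), uniformly in the level on compacts of `(-4, 0)` (`count_pairs_exists`):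
transversal fibres (`count_transversal`), reindexing by the shift `k` and the three shift ranges (`count_reindex`,
`krange`), the Cooper range with its logarithm (`count_odd_total`), the fold ranges injected into anti-diagonal
counts (`count_even_pos/neg`, `count_anti_sigma`), the level counts of the diagonal function and the dyadic depth
summation (`count_levels_diag`, `dyadic_total`, `count_anti_total`); the elimination of the third sector index
(`card_prod3_le`) and the choice of the small constants (`exists_small_constants`). This is the counting scheme of
Benfatto–Giuliani–Mastropietro 2006, App. A2, reorganised into one-dimensional fibrations.

Everything is PROVED. [folklore]

## Sources

* G. Benfatto, A. Giuliani, V. Mastropietro, Ann. Henri Poincaré 7 (2006) 809–898, App. A2. [BenfattoGiulianiMastropietro2006]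
-/

noncomputable section

open Real Set
open Literature.MathematicalPhysics.QuantumLattice

namespace Literature.MathematicalPhysics.QuantumLattice.BandSectorCounting

/-! ## Periodicity and symmetry of the level function on the grid -/

section Periodic

variable {μ : ℝ} (hμ₁ : -4 < μ) (hμ₂ : μ < 0)
include hμ₁ hμ₂

/-- `h` is `2π`-periodic in `θ₃`. [folklore] -/
theorem hfun_add_two_pi_three (θ₁ θ₂ θ₃ : ℝ) (m : ℤ) :
    hfun μ θ₁ θ₂ (θ₃ + m * (2 * π)) = hfun μ θ₁ θ₂ θ₃ := by
  obtain ⟨hx, hy, -, -⟩ := band_add_int_mul_two_pi hμ₁ hμ₂ θ₃ m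
  unfold hfun SX SY; rw [hx, hy]

/-- `∂₃ h` is `2π`-periodic in `θ₃`. [folklore] -/
theorem h3_add_two_pi_three (θ₁ θ₂ θ₃ : ℝ) (m : ℤ) :
    h3 μ θ₁ θ₂ (θ₃ + m * (2 * π)) = h3 μ θ₁ θ₂ θ₃ := by
  obtain ⟨hx, hy, hvx, hvy⟩ := band_add_int_mul_two_pi hμ₁ hμ₂ θ₃ m
  unfold h3 SX SY; rw [hx, hy, hvx, hvy]

/-- `∂₃ h` is `2π`-periodic in `θ₂`. [folklore] -/
theorem h3_add_two_pi_two (θ₁ θ₂ θ₃ : ℝ) (m : ℤ) :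
    h3 μ θ₁ (θ₂ + m * (2 * π)) θ₃ = h3 μ θ₁ θ₂ θ₃ := by
  obtain ⟨hx, hy, -, -⟩ := band_add_int_mul_two_pi hμ₁ hμ₂ θ₂ m
  unfold h3 SX SY; rw [hx, hy]

omit hμ₁ hμ₂ in
/-- `G = ∂₂ h + ∂₃ h` on the anti-diagonal. [folklore] -/
theorem Gfun_eq_h3_add (θ₁ σ t : ℝ) :
    Gfun μ θ₁ σ t = h3 μ θ₁ (σ + t / 2) (σ - t / 2) + h3 μ θ₁ (σ - t / 2) (σ + t / 2) := by
  unfold Gfun h3; rw [SX_swap μ θ₁ (σ + t / 2) (σ - t / 2), SY_swap μ θ₁ (σ + t / 2) (σ - t / 2)]; ring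

end Periodic

/-! ## The grid counts: transversal part -/

section Assembly

variable {a b : ℝ} (B : BandBounds a b) {μ : ℝ} (hμ : μ ∈ Icc a b)
include B hμ

/-- **Transversal part** (fibre over `θ₂`): `Σ_{a<N} #{c<N : |h| ≤ δ, |∂₃h| ≥ λ} ≤ N·C₃`. [folklore] -/
theorem count_transversal {θ₁ w δ lam : ℝ} (hw : 0 < w) (hlam : 0 < lam) (hδ : 0 ≤ δ) {N : ℕ}
    (hN : (N : ℝ) * w = 2 * π) :
    ∑ i ∈ Finset.range N, ((((Finset.range N).filter fun c : ℕ =>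
        |hfun μ θ₁ (w / 2 + i * w) (w / 2 + c * w)| ≤ δ ∧ lam ≤ |h3 μ θ₁ (w / 2 + i * w) (w / 2 + c * w)|).card : ℝ)) ≤
      N * ((2 * π / (lam / (2 * (4 * B.smax ^ 2 + 4 * B.A2))) + 1) * (2 * ((4 * δ / lam) / w + 1))) := by
  obtain ⟨h1, h2⟩ := B.level hμ
  have hA : 0 < 4 * B.smax ^ 2 + 4 * B.A2 := by have := B.smax_pos; have := B.A2_pos; positivity
  have hterm : ∀ i ∈ Finset.range N, ((((Finset.range N).filter fun c : ℕ =>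
        |hfun μ θ₁ (w / 2 + i * w) (w / 2 + c * w)| ≤ δ ∧ lam ≤ |h3 μ θ₁ (w / 2 + i * w) (w / 2 + c * w)|).card : ℝ)) ≤
      (2 * π / (lam / (2 * (4 * B.smax ^ 2 + 4 * B.A2))) + 1) * (2 * ((4 * δ / lam) / w + 1)) := by
    intro i _
    have := gridCount_L2 (g := fun x => hfun μ θ₁ (w / 2 + i * w) x) (g' := fun x => h3 μ θ₁ (w / 2 + i * w) x)
      (hasDerivAt_hfun_three h1 h2 θ₁ _) hA hlam hδ (abs_h3_sub_le B hμ θ₁ _) (x₀ := w / 2) hw N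
    rw [hN] at this
    exact this
  calc _ ≤ ∑ i ∈ Finset.range N, (2 * π / (lam / (2 * (4 * B.smax ^ 2 + 4 * B.A2))) + 1) * (2 * ((4 * δ / lam) / w + 1)) :=
        Finset.sum_le_sum hterm
    _ = _ := by rw [Finset.sum_const, Finset.card_range, nsmul_eq_mul]

/-- **Transversal part, other leg** (fibre over `θ₃`). [folklore] -/
theorem count_transversal' {θ₁ w δ lam : ℝ} (hw : 0 < w) (hlam : 0 < lam) (hδ : 0 ≤ δ) {N : ℕ}
    (hN : (N : ℝ) * w = 2 * π) :
    ∑ c ∈ Finset.range N, ((((Finset.range N).filter fun i : ℕ =>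
        |hfun μ θ₁ (w / 2 + i * w) (w / 2 + c * w)| ≤ δ ∧ lam ≤ |h3 μ θ₁ (w / 2 + c * w) (w / 2 + i * w)|).card : ℝ)) ≤
      N * ((2 * π / (lam / (2 * (4 * B.smax ^ 2 + 4 * B.A2))) + 1) * (2 * ((4 * δ / lam) / w + 1))) := by
  have h := count_transversal B hμ (θ₁ := θ₁) hw hlam hδ hN
  refine le_trans (le_of_eq ?_) h
  refine Finset.sum_congr rfl fun c _ => ?_
  congr 2
  refine Finset.filter_congr fun i _ => ?_
  rw [hfun_swap μ θ₁ (w / 2 + i * w) (w / 2 + c * w)]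

omit B hμ in
/-- Cardinality of a filtered square as an iterated sum over the first coordinate. [folklore] -/
theorem card_filter_prod_eq_sum (N : ℕ) (Q : ℕ → ℕ → Prop) [DecidablePred fun p : ℕ × ℕ => Q p.1 p.2]
    [∀ i, DecidablePred (Q i)] :
    (((Finset.range N ×ˢ Finset.range N).filter fun p : ℕ × ℕ => Q p.1 p.2).card : ℝ) =
      ∑ i ∈ Finset.range N, ((((Finset.range N).filter fun c => Q i c).card : ℝ)) := by
  rw [Finset.card_filter]
  push_cast
  rw [Finset.sum_product]
  refine Finset.sum_congr rfl fun i _ => ?_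
  rw [Finset.card_filter]; push_cast; rfl

omit B hμ in
/-- Cardinality of a filtered square as an iterated sum over the second coordinate. [folklore] -/
theorem card_filter_prod_eq_sum' (N : ℕ) (Q : ℕ → ℕ → Prop) [DecidablePred fun p : ℕ × ℕ => Q p.1 p.2]
    [∀ c, DecidablePred fun i => Q i c] :
    (((Finset.range N ×ˢ Finset.range N).filter fun p : ℕ × ℕ => Q p.1 p.2).card : ℝ) =
      ∑ c ∈ Finset.range N, ((((Finset.range N).filter fun i => Q i c).card : ℝ)) := by
  rw [Finset.card_filter]
  push_cast
  rw [Finset.sum_product, Finset.sum_comm]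
  refine Finset.sum_congr rfl fun c _ => ?_
  rw [Finset.card_filter]; push_cast; rfl


/-! ## The grid counts: reindexing by the shift `k` and the three `k`-ranges -/

/-- **Reindexing** `(a, c) ↦ (a, k)` with `c ≡ a + k (mod N)`: the count of pairs with both partial
derivatives small is at most the sum over shifts `k` of the counts along `θ₃ = θ₂ + k w`. [folklore] -/
theorem count_reindex {θ₁ w δ lam : ℝ} {N : ℕ} (hN : (N : ℝ) * w = 2 * π) :
    ((((Finset.range N ×ˢ Finset.range N).filter fun p : ℕ × ℕ =>
        |hfun μ θ₁ (w / 2 + p.1 * w) (w / 2 + p.2 * w)| ≤ δ ∧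
        |h3 μ θ₁ (w / 2 + p.1 * w) (w / 2 + p.2 * w)| < lam ∧
        |h3 μ θ₁ (w / 2 + p.2 * w) (w / 2 + p.1 * w)| < lam).card : ℝ)) ≤
      ∑ k ∈ Finset.range N, ((((Finset.range N).filter fun i : ℕ =>
        |hfun μ θ₁ (w / 2 + i * w) (w / 2 + i * w + k * w)| ≤ δ ∧
        |h3 μ θ₁ (w / 2 + i * w) (w / 2 + i * w + k * w)| < lam ∧
        |h3 μ θ₁ (w / 2 + i * w + k * w) (w / 2 + i * w)| < lam).card : ℝ)) := by
  obtain ⟨h1, h2⟩ := B.level hμ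
  rw [← card_filter_prod_eq_sum' N (fun i k =>
        |hfun μ θ₁ (w / 2 + i * w) (w / 2 + i * w + k * w)| ≤ δ ∧
        |h3 μ θ₁ (w / 2 + i * w) (w / 2 + i * w + k * w)| < lam ∧
        |h3 μ θ₁ (w / 2 + i * w + k * w) (w / 2 + i * w)| < lam)]
  norm_cast
  refine Finset.card_le_card_of_injOn (fun p : ℕ × ℕ => (p.1, if p.1 ≤ p.2 then p.2 - p.1 else p.2 + N - p.1)) ?_ ?_
  · intro p hp
    rw [Finset.mem_coe, Finset.mem_filter, Finset.mem_product, Finset.mem_range, Finset.mem_range] at hp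
    obtain ⟨⟨ha, hc⟩, hQ⟩ := hp
    rw [Finset.mem_coe, Finset.mem_filter, Finset.mem_product, Finset.mem_range, Finset.mem_range]
    dsimp only
    refine ⟨⟨ha, ?_⟩, ?_⟩
    · split_ifs <;> omega
    · split_ifs with hle
      · have : w / 2 + (p.1 : ℝ) * w + ((p.2 - p.1 : ℕ) : ℝ) * w = w / 2 + p.2 * w := by
          rw [Nat.cast_sub hle]; ring
        rw [this]; exact hQ
      · push Not at hle
        have : w / 2 + (p.1 : ℝ) * w + ((p.2 + N - p.1 : ℕ) : ℝ) * w = w / 2 + p.2 * w + (1 : ℤ) * (2 * π) := by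
          rw [Nat.cast_sub (by omega : p.1 ≤ p.2 + N)]; push_cast; rw [← hN]; ring
        rw [this, hfun_add_two_pi_three h1 h2, h3_add_two_pi_three h1 h2, h3_add_two_pi_two h1 h2]
        exact hQ
  · intro p hp q hq hpq
    rw [Finset.mem_coe, Finset.mem_filter, Finset.mem_product, Finset.mem_range, Finset.mem_range] at hp hq
    simp only [Prod.mk.injEq] at hpq
    obtain ⟨h1', h2'⟩ := hpq
    have : p.2 = q.2 := by
      split_ifs at h2' <;> omega
    exact Prod.ext h1' this

/-- **The three shift ranges**: if along `θ₃ = θ₂ + k w` (`k < N`) the level function and both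
partials are small somewhere, then `k w ≤ τ`, or `|k w - π| ≤ τ`, or `k w ≥ 2π - τ`. [folklore] -/
theorem krange {θ₁ w δ lam τ η₀ : ℝ} (hw : 0 < w) {N k : ℕ} (hN : (N : ℝ) * w = 2 * π) (hk : k < N)
    (hτ : τ < π) (hlo : a ≤ μ - η₀) (hhi : μ + η₀ ≤ b) (hδη : δ ≤ η₀)
    (hsmall : 2 * (B.Cg * (lam / 2 + 2 * B.smax * (η₀ / B.Dtmin))) ≤ τ) {x : ℝ}
    (hQ : |hfun μ θ₁ x (x + k * w)| ≤ δ ∧ |h3 μ θ₁ x (x + k * w)| < lam ∧ |h3 μ θ₁ (x + k * w) x| < lam) :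
    (k : ℝ) * w ≤ τ ∨ |(k : ℝ) * w - π| ≤ τ ∨ 2 * π - τ ≤ (k : ℝ) * w := by
  obtain ⟨j, hj⟩ := cover B hμ hlo hhi (hQ.1.trans hδη) hQ.2.2.le hQ.2.1.le hsmall
  rw [show x + k * w - x = (k : ℝ) * w by ring] at hj
  have hk0 : 0 ≤ (k : ℝ) * w := by positivity
  have hkN : (k : ℝ) * w < 2 * π := by
    calc (k : ℝ) * w < N * w := mul_lt_mul_of_pos_right (by exact_mod_cast hk) hw
      _ = 2 * π := hN
  have hτ0 : 0 ≤ τ := (abs_nonneg _).trans hj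
  have hπ := Real.pi_pos
  have hjge : 0 ≤ j := by
    by_contra hneg
    push Not at hneg
    have : (j : ℝ) ≤ -1 := by exact_mod_cast Int.le_sub_one_of_lt hneg
    have h' := (abs_le.1 hj).2
    nlinarith
  have hjle : j ≤ 2 := by
    by_contra hneg
    push Not at hneg
    have : (3 : ℝ) ≤ j := by exact_mod_cast hneg
    have h' := (abs_le.1 hj).1
    nlinarith
  interval_cases j
  · left; simpa using (abs_le.1 hj).2
  · right; left; simpa using hj
  · right; right
    have h' := (abs_le.1 hj).1
    push_cast at h'; linarith

omit B hμ in
/-- Splitting a sum over `k < N` according to the three shift ranges, when the summand vanishes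
outside them. [folklore] -/
theorem sum_split_three {N : ℕ} (f : ℕ → ℝ) (A Bo C : ℕ → Prop) [DecidablePred A] [DecidablePred Bo]
    [DecidablePred C] (hf : ∀ k, 0 ≤ f k) (hzero : ∀ k ∈ Finset.range N, f k ≠ 0 → A k ∨ Bo k ∨ C k) :
    ∑ k ∈ Finset.range N, f k ≤ ∑ k ∈ (Finset.range N).filter A, f k +
      ∑ k ∈ (Finset.range N).filter Bo, f k + ∑ k ∈ (Finset.range N).filter C, f k := by
  rw [Finset.sum_filter, Finset.sum_filter, Finset.sum_filter, ← Finset.sum_add_distrib, ← Finset.sum_add_distrib]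
  refine Finset.sum_le_sum fun k hk => ?_
  by_cases h0 : f k = 0
  · rw [h0]; split_ifs <;> simp
  · have := hf k
    rcases hzero k hk h0 with h | h | h <;> simp only [h, if_true] <;> split_ifs <;> linarith


/-! ## The grid counts: the Cooper range `|k w - π| ≤ τ` -/

/-- The `θ₂`-derivative of `θ₂ ↦ h(θ₂, θ₂ + c)` is at most `4 A₂ |c - π|`. [folklore] -/
theorem abs_diag_deriv_odd_le (θ₁ c x : ℝ) :
    |2 * Real.sin (SX μ θ₁ x (x + c)) * (bandVX μ x + bandVX μ (x + c)) +
        2 * Real.sin (SY μ θ₁ x (x + c)) * (bandVY μ x + bandVY μ (x + c))| ≤ 4 * B.A2 * |c - π| := by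
  obtain ⟨h1, h2⟩ := B.level hμ
  obtain ⟨-, -, hvx, hvy⟩ := band_add_pi h1 h2 (x + (c - π))
  rw [show x + (c - π) + π = x + c by ring] at hvx hvy
  have e1 : |bandVX μ x + bandVX μ (x + c)| ≤ B.A2 * |c - π| := by
    rw [hvx, ← sub_eq_add_neg]
    refine (abs_bandVX_sub_le B hμ _ _).trans ?_
    rw [show x - (x + (c - π)) = -(c - π) by ring, abs_neg]
  have e2 : |bandVY μ x + bandVY μ (x + c)| ≤ B.A2 * |c - π| := by
    rw [hvy, ← sub_eq_add_neg]
    refine (abs_bandVY_sub_le B hμ _ _).trans ?_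
    rw [show x - (x + (c - π)) = -(c - π) by ring, abs_neg]
  have hs1 : |2 * Real.sin (SX μ θ₁ x (x + c))| ≤ 2 := by
    rw [abs_mul, abs_two]; linarith [Real.abs_sin_le_one (SX μ θ₁ x (x + c))]
  have hs2 : |2 * Real.sin (SY μ θ₁ x (x + c))| ≤ 2 := by
    rw [abs_mul, abs_two]; linarith [Real.abs_sin_le_one (SY μ θ₁ x (x + c))]
  have := abs_two_term_le hs1 e1 hs2 e2
  linarith

/-- **The count along a fixed Cooper-range shift** `c = k w`, `2δ/η_o ≤ |c - π| ≤ τ`: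
`#{a < N : |h(θ_a, θ_a + c)| ≤ δ} ≤ (16πA₂/η_o + 1)·2·(2δ/(h_min |c - π| w) + 1)`. [folklore] -/
theorem count_odd_shift {θ₁ w δ τ ηo c : ℝ} (hw : 0 < w) {N : ℕ} (hN : (N : ℝ) * w = 2 * π) (hδ : 0 ≤ δ)
    (hηo : 0 < ηo) (hc : |c - π| ≤ τ) (hcpos : 0 < |c - π|) (hδc : δ ≤ ηo * |c - π| / 2)
    (hsmall : 4 * B.A2 * B.smax * (2 * τ + 2 * B.Cg * B.smax ^ 2 * τ + B.Cg * (ηo / 2)) ≤ B.hmin) :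
    ((((Finset.range N).filter fun i : ℕ => |hfun μ θ₁ (w / 2 + i * w) (w / 2 + i * w + c)| ≤ δ).card : ℝ)) ≤
      (2 * π / (ηo / (8 * B.A2)) + 1) * (2 * ((2 * δ / (B.hmin * |c - π|)) / w + 1)) := by
  obtain ⟨h1, h2⟩ := B.level hμ
  have hA := B.A2_pos; have hh := B.hmin_pos
  have hcπ : c ≠ π := fun h => by rw [h, sub_self, abs_zero] at hcpos; exact lt_irrefl _ hcpos
  have h := gridCount_L3 (g := fun x => hfun μ θ₁ x (x + c))
    (g' := fun x => 2 * Real.sin (SX μ θ₁ x (x + c)) * (bandVX μ x + bandVX μ (x + c)) +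
        2 * Real.sin (SY μ θ₁ x (x + c)) * (bandVY μ x + bandVY μ (x + c)))
    (hasDerivAt_hfun_diag h1 h2 θ₁ c) (M₁ := 4 * B.A2 * |c - π|) (lam := B.hmin * |c - π|)
    (η₀ := ηo * |c - π|) (δ := δ) (by positivity) (by positivity) (by positivity) hδ hδc
    (abs_diag_deriv_odd_le B hμ θ₁ c)
    (fun x hx => odd_transversal B hμ hc hcπ hx hsmall) (x₀ := w / 2) hw N
  rw [hN] at h
  have e1 : ηo * |c - π| / (2 * (4 * B.A2 * |c - π|)) = ηo / (8 * B.A2) := by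
    field_simp; norm_num
  rw [e1] at h
  exact h

omit B hμ in
/-- A set of shifts `k < N` all within `d` of `π/w` has at most `2d + 1` elements. [folklore] -/
theorem card_shifts_near_pi_le {w d : ℝ} (hw : 0 < w) (hd : 0 ≤ d) (N : ℕ) (P : ℕ → Prop) [DecidablePred P] :
    ((((Finset.range N).filter fun k : ℕ => |(k : ℝ) * w - π| < d * w ∧ P k).card : ℝ)) ≤ 2 * d + 1 := by
  refine natCard_le_of_diam (by positivity) fun i hi j hj => ?_
  rw [Finset.mem_filter] at hi hj
  have h1 := hi.2.1; have h2 := hj.2.1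
  have : ((j : ℝ) - i) * w = ((j : ℝ) * w - π) - ((i : ℝ) * w - π) := by ring
  have habs : |((j : ℝ) - i) * w| ≤ 2 * d * w := by
    rw [this]; refine (abs_sub _ _).trans ?_; linarith
  rw [abs_mul, abs_of_pos hw] at habs
  have := le_abs_self ((j : ℝ) - i)
  nlinarith

/-- **The Cooper range in total**: `Σ_{|kw - π| ≤ τ} #{a : Q'(a, k)} ≤
N (4δ/(η_o w) + 1) + 2 C₅ ((2δ/(h_min w)) (2 (1 + log N))/w + N)`. [folklore] -/
theorem count_odd_total {θ₁ w δ lam τ ηo : ℝ} (hw : 0 < w) {N Nh : ℕ} (hN : (N : ℝ) * w = 2 * π)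
    (hNh : (Nh : ℝ) * w = π) (hNN : N = 2 * Nh) (hδ : 0 < δ) (hηo : 0 < ηo)
    (hsmall : 4 * B.A2 * B.smax * (2 * τ + 2 * B.Cg * B.smax ^ 2 * τ + B.Cg * (ηo / 2)) ≤ B.hmin) :
    ∑ k ∈ (Finset.range N).filter (fun k : ℕ => |(k : ℝ) * w - π| ≤ τ), ((((Finset.range N).filter fun i : ℕ =>
        |hfun μ θ₁ (w / 2 + i * w) (w / 2 + i * w + k * w)| ≤ δ ∧
        |h3 μ θ₁ (w / 2 + i * w) (w / 2 + i * w + k * w)| < lam ∧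
        |h3 μ θ₁ (w / 2 + i * w + k * w) (w / 2 + i * w)| < lam).card : ℝ)) ≤
      N * (2 * (2 * δ / (ηo * w)) + 1) +
      2 * (2 * π / (ηo / (8 * B.A2)) + 1) * ((2 * δ / (B.hmin * w)) * (2 * (1 + Real.log N)) / w + N) := by
  have hA := B.A2_pos; have hh := B.hmin_pos
  have hNh0 : 0 < Nh := by
    rcases Nat.eq_zero_or_pos Nh with h0 | h0
    · exfalso; rw [h0] at hNh; simp at hNh; linarith [Real.pi_pos]
    · exact h0
  have hNhN : Nh < N := by omega
  set S := (Finset.range N).filter (fun k : ℕ => |(k : ℝ) * w - π| ≤ τ) with hS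
  set f : ℕ → ℝ := fun k => ((((Finset.range N).filter fun i : ℕ =>
        |hfun μ θ₁ (w / 2 + i * w) (w / 2 + i * w + k * w)| ≤ δ ∧
        |h3 μ θ₁ (w / 2 + i * w) (w / 2 + i * w + k * w)| < lam ∧
        |h3 μ θ₁ (w / 2 + i * w + k * w) (w / 2 + i * w)| < lam).card : ℝ)) with hf
  have hf0 : ∀ k, 0 ≤ f k := fun k => by positivity
  have hfN : ∀ k, f k ≤ N := by
    intro k
    rw [hf]; dsimp only
    have := Finset.card_filter_le (Finset.range N) (fun i : ℕ =>
        |hfun μ θ₁ (w / 2 + i * w) (w / 2 + i * w + k * w)| ≤ δ ∧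
        |h3 μ θ₁ (w / 2 + i * w) (w / 2 + i * w + k * w)| < lam ∧
        |h3 μ θ₁ (w / 2 + i * w + k * w) (w / 2 + i * w)| < lam)
    rw [Finset.card_range] at this
    exact_mod_cast this
  -- split `S` into the trivial shifts and the good shifts
  set d := 2 * δ / (ηo * w) with hd
  have hd0 : 0 ≤ d := by positivity
  have hdw : d * w = 2 * δ / ηo := by rw [hd]; field_simp
  rw [← Finset.sum_filter_add_sum_filter_not S (fun k : ℕ => |(k : ℝ) * w - π| < d * w)]
  have htriv : ∑ k ∈ S.filter (fun k : ℕ => |(k : ℝ) * w - π| < d * w), f k ≤ N * (2 * d + 1) := by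
    have hcard : (((S.filter (fun k : ℕ => |(k : ℝ) * w - π| < d * w)).card : ℝ)) ≤ 2 * d + 1 := by
      have : S.filter (fun k : ℕ => |(k : ℝ) * w - π| < d * w) =
          (Finset.range N).filter (fun k : ℕ => |(k : ℝ) * w - π| < d * w ∧ |(k : ℝ) * w - π| ≤ τ) := by
        rw [hS, Finset.filter_filter]
        refine Finset.filter_congr fun k _ => ?_
        tauto
      rw [this]; exact card_shifts_near_pi_le hw hd0 N _
    calc ∑ k ∈ S.filter (fun k : ℕ => |(k : ℝ) * w - π| < d * w), f k
        ≤ ∑ k ∈ S.filter (fun k : ℕ => |(k : ℝ) * w - π| < d * w), (N : ℝ) := Finset.sum_le_sum fun k _ => hfN k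
      _ = ((S.filter (fun k : ℕ => |(k : ℝ) * w - π| < d * w)).card : ℝ) * N := by rw [Finset.sum_const, nsmul_eq_mul]
      _ ≤ (2 * d + 1) * N := mul_le_mul_of_nonneg_right hcard (by positivity)
      _ = N * (2 * d + 1) := by ring
  have hgood : ∑ k ∈ S.filter (fun k : ℕ => ¬ |(k : ℝ) * w - π| < d * w), f k ≤
      2 * (2 * π / (ηo / (8 * B.A2)) + 1) * ((2 * δ / (B.hmin * w)) * (2 * (1 + Real.log N)) / w + N) := by
    set C₅ := 2 * π / (ηo / (8 * B.A2)) + 1 with hC₅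
    have hC₅0 : 0 ≤ C₅ := by positivity
    have hterm : ∀ k ∈ S.filter (fun k : ℕ => ¬ |(k : ℝ) * w - π| < d * w),
        f k ≤ C₅ * (2 * ((2 * δ / (B.hmin * w)) * (1 / |(k : ℝ) - Nh|) / w + 1)) := by
      intro k hk
      rw [Finset.mem_filter, hS, Finset.mem_filter, Finset.mem_range, not_lt] at hk
      obtain ⟨⟨hkN, hkτ⟩, hkd⟩ := hk
      rw [hdw] at hkd
      have hcpos : 0 < |(k : ℝ) * w - π| := lt_of_lt_of_le (by positivity) hkd
      have hmono : f k ≤ ((((Finset.range N).filter fun i : ℕ =>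
          |hfun μ θ₁ (w / 2 + i * w) (w / 2 + i * w + k * w)| ≤ δ).card : ℝ)) := by
        rw [hf]; dsimp only
        have hsub' : ((Finset.range N).filter fun i : ℕ =>
            |hfun μ θ₁ (w / 2 + i * w) (w / 2 + i * w + k * w)| ≤ δ ∧
            |h3 μ θ₁ (w / 2 + i * w) (w / 2 + i * w + k * w)| < lam ∧
            |h3 μ θ₁ (w / 2 + i * w + k * w) (w / 2 + i * w)| < lam) ⊆
            ((Finset.range N).filter fun i : ℕ => |hfun μ θ₁ (w / 2 + i * w) (w / 2 + i * w + k * w)| ≤ δ) := by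
          intro i hi
          rw [Finset.mem_filter] at hi ⊢
          exact ⟨hi.1, hi.2.1⟩
        exact_mod_cast Finset.card_le_card hsub'
      have hδc : δ ≤ ηo * |(k : ℝ) * w - π| / 2 := by
        have : 2 * δ ≤ ηo * |(k : ℝ) * w - π| := by rw [div_le_iff₀' hηo] at hkd; linarith
        linarith
      have hL := count_odd_shift B hμ (θ₁ := θ₁) hw hN hδ.le hηo hkτ hcpos hδc hsmall
      have hkey : |(k : ℝ) * w - π| = |(k : ℝ) - Nh| * w := by
        rw [← hNh, show (k : ℝ) * w - Nh * w = ((k : ℝ) - Nh) * w by ring, abs_mul, abs_of_pos hw]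
      refine hmono.trans (hL.trans (le_of_eq ?_))
      rw [hkey, hC₅]
      have hkNh : (k : ℝ) - Nh ≠ 0 := by
        intro h0; rw [hkey, h0, abs_zero, zero_mul] at hcpos; exact lt_irrefl _ hcpos
      have habs : |(k : ℝ) - Nh| ≠ 0 := abs_ne_zero.2 hkNh
      field_simp
    have hsub : S.filter (fun k : ℕ => ¬ |(k : ℝ) * w - π| < d * w) ⊆ (Finset.range N).filter (fun k => k ≠ Nh) := by
      intro k hk
      rw [Finset.mem_filter, hS, Finset.mem_filter, not_lt] at hk
      rw [Finset.mem_filter]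
      refine ⟨hk.1.1, fun hkeq => ?_⟩
      rw [hkeq, hNh, sub_self, abs_zero, hdw] at hk
      have : 0 < 2 * δ / ηo := by positivity
      linarith [hk.2]
    calc ∑ k ∈ S.filter (fun k : ℕ => ¬ |(k : ℝ) * w - π| < d * w), f k
        ≤ ∑ k ∈ S.filter (fun k : ℕ => ¬ |(k : ℝ) * w - π| < d * w),
            C₅ * (2 * ((2 * δ / (B.hmin * w)) * (1 / |(k : ℝ) - Nh|) / w + 1)) := Finset.sum_le_sum hterm
      _ ≤ ∑ k ∈ (Finset.range N).filter (fun k => k ≠ Nh),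
            C₅ * (2 * ((2 * δ / (B.hmin * w)) * (1 / |(k : ℝ) - Nh|) / w + 1)) :=
          Finset.sum_le_sum_of_subset_of_nonneg hsub fun k _ _ => by positivity
      _ = (2 * C₅ * (2 * δ / (B.hmin * w)) / w) * ∑ k ∈ (Finset.range N).filter (fun k => k ≠ Nh), 1 / |(k : ℝ) - Nh|
            + 2 * C₅ * (((Finset.range N).filter (fun k => k ≠ Nh)).card : ℝ) := by
          have hrw : ∀ k : ℕ, C₅ * (2 * ((2 * δ / (B.hmin * w)) * (1 / |(k : ℝ) - Nh|) / w + 1)) =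
              (2 * C₅ * (2 * δ / (B.hmin * w)) / w) * (1 / |(k : ℝ) - Nh|) + 2 * C₅ := by
            intro k; ring
          rw [Finset.sum_congr rfl (fun k _ => hrw k), Finset.sum_add_distrib, ← Finset.mul_sum, Finset.sum_const,
            nsmul_eq_mul]
          ring
      _ ≤ (2 * C₅ * (2 * δ / (B.hmin * w)) / w) * (2 * (1 + Real.log N)) + 2 * C₅ * N := by
          apply add_le_add
          · exact mul_le_mul_of_nonneg_left (sum_inv_abs_sub_le hNhN) (by positivity)
          · apply mul_le_mul_of_nonneg_left _ (by positivity)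
            calc ((((Finset.range N).filter (fun k => k ≠ Nh)).card : ℝ)) ≤ ((Finset.range N).card : ℝ) := by
                  exact_mod_cast Finset.card_filter_le _ _
              _ = N := by rw [Finset.card_range]
      _ = 2 * C₅ * ((2 * δ / (B.hmin * w)) * (2 * (1 + Real.log N)) / w + N) := by ring
  rw [hd] at htriv
  linarith


/-! ## The grid counts: the fold ranges `k w ≤ τ` and `k w ≥ 2π - τ` -/

omit B hμ in
/-- Cardinality of a filtered product as an iterated sum over the second factor. [folklore] -/
theorem card_filter_product_eq_sum_snd (S T : Finset ℕ) (Q : ℕ → ℕ → Prop)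
    [DecidablePred fun p : ℕ × ℕ => Q p.1 p.2] [∀ c, DecidablePred fun i => Q i c] :
    (((S ×ˢ T).filter fun p : ℕ × ℕ => Q p.1 p.2).card : ℝ) = ∑ c ∈ T, (((S.filter fun i => Q i c).card : ℝ)) := by
  rw [Finset.card_filter]
  push_cast
  rw [Finset.sum_product, Finset.sum_comm]
  refine Finset.sum_congr rfl fun c _ => ?_
  rw [Finset.card_filter]; push_cast; rfl

omit B hμ in
/-- Cardinality of a filtered product as an iterated sum over the first factor. [folklore] -/
theorem card_filter_product_eq_sum_fst (S T : Finset ℕ) (Q : ℕ → ℕ → Prop)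
    [DecidablePred fun p : ℕ × ℕ => Q p.1 p.2] [∀ i, DecidablePred (Q i)] :
    (((S ×ˢ T).filter fun p : ℕ × ℕ => Q p.1 p.2).card : ℝ) = ∑ i ∈ S, (((T.filter fun c => Q i c).card : ℝ)) := by
  rw [Finset.card_filter]
  push_cast
  rw [Finset.sum_product]
  refine Finset.sum_congr rfl fun i _ => ?_
  rw [Finset.card_filter]; push_cast; rfl

omit B hμ in
/-- **The fold range `0 < k w ≤ τ` injects into the anti-diagonal counts**:
`(a, k) ↦ (s, i) = (2a + k, k - 1)`, `σ_s = w/2 + s w/2`, `t = (i + 1) w`. [folklore] -/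
theorem count_even_pos {θ₁ w δ lam τ : ℝ} (hw : 0 < w) {N : ℕ} :
    ∑ k ∈ (Finset.range N).filter (fun k : ℕ => (k : ℝ) * w ≤ τ), ((((Finset.range N).filter fun i : ℕ =>
        |hfun μ θ₁ (w / 2 + i * w) (w / 2 + i * w + k * w)| ≤ δ ∧
        |h3 μ θ₁ (w / 2 + i * w) (w / 2 + i * w + k * w)| < lam ∧
        |h3 μ θ₁ (w / 2 + i * w + k * w) (w / 2 + i * w)| < lam).card : ℝ)) ≤
      N + ∑ s ∈ Finset.range (4 * N), ((((Finset.range ⌊τ / w⌋₊).filter fun i : ℕ =>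
        |hfun μ θ₁ (w / 2 + s * (w / 2) - (w + i * w) / 2) (w / 2 + s * (w / 2) + (w + i * w) / 2)| ≤ δ ∧
        |Gfun μ θ₁ (w / 2 + s * (w / 2)) (w + i * w)| ≤ 2 * lam).card : ℝ)) := by
  set S := (Finset.range N).filter (fun k : ℕ => (k : ℝ) * w ≤ τ) with hS
  set f : ℕ → ℝ := fun k => ((((Finset.range N).filter fun i : ℕ =>
        |hfun μ θ₁ (w / 2 + i * w) (w / 2 + i * w + k * w)| ≤ δ ∧
        |h3 μ θ₁ (w / 2 + i * w) (w / 2 + i * w + k * w)| < lam ∧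
        |h3 μ θ₁ (w / 2 + i * w + k * w) (w / 2 + i * w)| < lam).card : ℝ)) with hf
  have hfN : ∀ k, f k ≤ N := by
    intro k
    rw [hf]; dsimp only
    have := Finset.card_filter_le (Finset.range N) (fun i : ℕ =>
        |hfun μ θ₁ (w / 2 + i * w) (w / 2 + i * w + k * w)| ≤ δ ∧
        |h3 μ θ₁ (w / 2 + i * w) (w / 2 + i * w + k * w)| < lam ∧
        |h3 μ θ₁ (w / 2 + i * w + k * w) (w / 2 + i * w)| < lam)
    rw [Finset.card_range] at this
    exact_mod_cast this
  have hf0 : ∀ k, 0 ≤ f k := fun k => by positivity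
  -- split off `k = 0`
  rw [← Finset.sum_filter_add_sum_filter_not S (fun k : ℕ => k = 0)]
  have h0 : ∑ k ∈ S.filter (fun k : ℕ => k = 0), f k ≤ N := by
    have hsub : S.filter (fun k : ℕ => k = 0) ⊆ {0} := by
      intro k hk; rw [Finset.mem_filter] at hk; rw [Finset.mem_singleton]; exact hk.2
    calc ∑ k ∈ S.filter (fun k : ℕ => k = 0), f k ≤ ∑ k ∈ ({0} : Finset ℕ), f k :=
          Finset.sum_le_sum_of_subset_of_nonneg hsub fun k _ _ => hf0 k
      _ = f 0 := Finset.sum_singleton _ _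
      _ ≤ N := hfN 0
  have hpos : ∑ k ∈ S.filter (fun k : ℕ => ¬ k = 0), f k ≤
      ∑ s ∈ Finset.range (4 * N), ((((Finset.range ⌊τ / w⌋₊).filter fun i : ℕ =>
        |hfun μ θ₁ (w / 2 + s * (w / 2) - (w + i * w) / 2) (w / 2 + s * (w / 2) + (w + i * w) / 2)| ≤ δ ∧
        |Gfun μ θ₁ (w / 2 + s * (w / 2)) (w + i * w)| ≤ 2 * lam).card : ℝ)) := by
    rw [hf]
    rw [← card_filter_product_eq_sum_snd (Finset.range N) (S.filter (fun k : ℕ => ¬ k = 0)) (fun i k =>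
        |hfun μ θ₁ (w / 2 + i * w) (w / 2 + i * w + k * w)| ≤ δ ∧
        |h3 μ θ₁ (w / 2 + i * w) (w / 2 + i * w + k * w)| < lam ∧
        |h3 μ θ₁ (w / 2 + i * w + k * w) (w / 2 + i * w)| < lam),
      ← card_filter_product_eq_sum_fst (Finset.range (4 * N)) (Finset.range ⌊τ / w⌋₊) (fun s i =>
        |hfun μ θ₁ (w / 2 + s * (w / 2) - (w + i * w) / 2) (w / 2 + s * (w / 2) + (w + i * w) / 2)| ≤ δ ∧
        |Gfun μ θ₁ (w / 2 + s * (w / 2)) (w + i * w)| ≤ 2 * lam)]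
    norm_cast
    refine Finset.card_le_card_of_injOn (fun p : ℕ × ℕ => (2 * p.1 + p.2, p.2 - 1)) ?_ ?_
    · intro p hp
      rw [Finset.mem_coe, Finset.mem_filter, Finset.mem_product, Finset.mem_range, Finset.mem_filter, hS,
        Finset.mem_filter, Finset.mem_range] at hp
      obtain ⟨⟨ha, ⟨hkN, hkτ⟩, hk0⟩, hQ⟩ := hp
      have hk1 : 1 ≤ p.2 := Nat.one_le_iff_ne_zero.2 hk0
      rw [Finset.mem_coe, Finset.mem_filter, Finset.mem_product, Finset.mem_range, Finset.mem_range]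
      dsimp only
      refine ⟨⟨by omega, ?_⟩, ?_⟩
      · -- `p.2 - 1 < ⌊τ/w⌋₊` since `p.2 ≤ τ / w`
        have : p.2 ≤ ⌊τ / w⌋₊ := by
          rw [Nat.le_floor_iff (by
            have : (0:ℝ) ≤ p.2 * w := by positivity
            exact div_nonneg (this.trans hkτ) hw.le)]
          rw [le_div_iff₀ hw]; exact hkτ
        omega
      · have e1 : w / 2 + ((2 * p.1 + p.2 : ℕ) : ℝ) * (w / 2) - (w + ((p.2 - 1 : ℕ) : ℝ) * w) / 2 = w / 2 + p.1 * w := by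
          rw [Nat.cast_sub hk1]; push_cast; ring
        have e2 : w / 2 + ((2 * p.1 + p.2 : ℕ) : ℝ) * (w / 2) + (w + ((p.2 - 1 : ℕ) : ℝ) * w) / 2 =
            w / 2 + p.1 * w + p.2 * w := by
          rw [Nat.cast_sub hk1]; push_cast; ring
        have e3 : w + ((p.2 - 1 : ℕ) : ℝ) * w = (p.2 : ℝ) * w := by rw [Nat.cast_sub hk1]; push_cast; ring
        rw [e1, e2, e3, Gfun_eq_h3_add]
        have e4 : w / 2 + ((2 * p.1 + p.2 : ℕ) : ℝ) * (w / 2) + (p.2 : ℝ) * w / 2 = w / 2 + p.1 * w + p.2 * w := by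
          push_cast; ring
        have e5 : w / 2 + ((2 * p.1 + p.2 : ℕ) : ℝ) * (w / 2) - (p.2 : ℝ) * w / 2 = w / 2 + p.1 * w := by
          push_cast; ring
        rw [e4, e5]
        refine ⟨hQ.1, ?_⟩
        calc _ ≤ |h3 μ θ₁ (w / 2 + p.1 * w + p.2 * w) (w / 2 + p.1 * w)| + |h3 μ θ₁ (w / 2 + p.1 * w) (w / 2 + p.1 * w + p.2 * w)| :=
              abs_add_le _ _
          _ ≤ 2 * lam := by linarith [hQ.2.1, hQ.2.2]
    · intro p hp q hq hpq
      rw [Finset.mem_coe, Finset.mem_filter, Finset.mem_product, Finset.mem_filter, hS, Finset.mem_filter] at hp hq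
      simp only [Prod.mk.injEq] at hpq
      have hp1 : 1 ≤ p.2 := Nat.one_le_iff_ne_zero.2 hp.1.2.2
      have hq1 : 1 ≤ q.2 := Nat.one_le_iff_ne_zero.2 hq.1.2.2
      have h2 : p.2 = q.2 := by omega
      have h1 : p.1 = q.1 := by omega
      exact Prod.ext h1 h2
  linarith

/-- **The fold range `k w ≥ 2π - τ` injects into the anti-diagonal counts**:
`(a, k) ↦ (s, i) = (2a + N + k, N - k - 1)`. [folklore] -/
theorem count_even_neg {θ₁ w δ lam τ : ℝ} (hw : 0 < w) {N : ℕ} (hN : (N : ℝ) * w = 2 * π) :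
    ∑ k ∈ (Finset.range N).filter (fun k : ℕ => 2 * π - τ ≤ (k : ℝ) * w), ((((Finset.range N).filter fun i : ℕ =>
        |hfun μ θ₁ (w / 2 + i * w) (w / 2 + i * w + k * w)| ≤ δ ∧
        |h3 μ θ₁ (w / 2 + i * w) (w / 2 + i * w + k * w)| < lam ∧
        |h3 μ θ₁ (w / 2 + i * w + k * w) (w / 2 + i * w)| < lam).card : ℝ)) ≤
      ∑ s ∈ Finset.range (4 * N), ((((Finset.range ⌊τ / w⌋₊).filter fun i : ℕ =>
        |hfun μ θ₁ (w / 2 + s * (w / 2) - (w + i * w) / 2) (w / 2 + s * (w / 2) + (w + i * w) / 2)| ≤ δ ∧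
        |Gfun μ θ₁ (w / 2 + s * (w / 2)) (w + i * w)| ≤ 2 * lam).card : ℝ)) := by
  obtain ⟨h1, h2⟩ := B.level hμ
  set S := (Finset.range N).filter (fun k : ℕ => 2 * π - τ ≤ (k : ℝ) * w) with hS
  rw [← card_filter_product_eq_sum_snd (Finset.range N) S (fun i k =>
        |hfun μ θ₁ (w / 2 + i * w) (w / 2 + i * w + k * w)| ≤ δ ∧
        |h3 μ θ₁ (w / 2 + i * w) (w / 2 + i * w + k * w)| < lam ∧
        |h3 μ θ₁ (w / 2 + i * w + k * w) (w / 2 + i * w)| < lam),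
    ← card_filter_product_eq_sum_fst (Finset.range (4 * N)) (Finset.range ⌊τ / w⌋₊) (fun s i =>
        |hfun μ θ₁ (w / 2 + s * (w / 2) - (w + i * w) / 2) (w / 2 + s * (w / 2) + (w + i * w) / 2)| ≤ δ ∧
        |Gfun μ θ₁ (w / 2 + s * (w / 2)) (w + i * w)| ≤ 2 * lam)]
  norm_cast
  refine Finset.card_le_card_of_injOn (fun p : ℕ × ℕ => (2 * p.1 + N + p.2, N - p.2 - 1)) ?_ ?_
  · intro p hp
    rw [Finset.mem_coe, Finset.mem_filter, Finset.mem_product, Finset.mem_range, hS, Finset.mem_filter,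
      Finset.mem_range] at hp
    obtain ⟨⟨ha, ⟨hkN, hkτ⟩⟩, hQ⟩ := hp
    rw [Finset.mem_coe, Finset.mem_filter, Finset.mem_product, Finset.mem_range, Finset.mem_range]
    dsimp only
    have hk1 : p.2 + 1 ≤ N := hkN
    refine ⟨⟨by omega, ?_⟩, ?_⟩
    · have hle : ((N - p.2 : ℕ) : ℝ) * w ≤ τ := by
        rw [Nat.cast_sub hkN.le, sub_mul, hN]; linarith
      have : N - p.2 ≤ ⌊τ / w⌋₊ := by
        rw [Nat.le_floor_iff (div_nonneg ((by positivity : (0:ℝ) ≤ ((N - p.2 : ℕ) : ℝ) * w).trans hle) hw.le),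
          le_div_iff₀ hw]
        exact hle
      omega
    · have ec : ((N - p.2 - 1 : ℕ) : ℝ) = (N : ℝ) - p.2 - 1 := by
        rw [Nat.cast_sub (by omega : 1 ≤ N - p.2), Nat.cast_sub hkN.le]; push_cast; ring
      have e1 : w / 2 + ((2 * p.1 + N + p.2 : ℕ) : ℝ) * (w / 2) - (w + ((N - p.2 - 1 : ℕ) : ℝ) * w) / 2 =
          w / 2 + p.1 * w + p.2 * w := by
        rw [ec]; push_cast; ring
      have e2 : w / 2 + ((2 * p.1 + N + p.2 : ℕ) : ℝ) * (w / 2) + (w + ((N - p.2 - 1 : ℕ) : ℝ) * w) / 2 =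
          w / 2 + p.1 * w + (1 : ℤ) * (2 * π) := by
        rw [ec]; push_cast; rw [← hN]; ring
      have e3 : w + ((N - p.2 - 1 : ℕ) : ℝ) * w = ((N : ℝ) - p.2) * w := by rw [ec]; ring
      rw [e1, e2, e3, Gfun_eq_h3_add, hfun_add_two_pi_three h1 h2, hfun_swap]
      have e4 : w / 2 + ((2 * p.1 + N + p.2 : ℕ) : ℝ) * (w / 2) + ((N : ℝ) - p.2) * w / 2 = w / 2 + p.1 * w + (1 : ℤ) * (2 * π) := by
        push_cast; rw [← hN]; ring
      have e5 : w / 2 + ((2 * p.1 + N + p.2 : ℕ) : ℝ) * (w / 2) - ((N : ℝ) - p.2) * w / 2 = w / 2 + p.1 * w + p.2 * w := by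
        push_cast; ring
      rw [e4, e5, h3_add_two_pi_two h1 h2, h3_add_two_pi_three h1 h2]
      refine ⟨hQ.1, ?_⟩
      calc _ ≤ |h3 μ θ₁ (w / 2 + p.1 * w) (w / 2 + p.1 * w + p.2 * w)| + |h3 μ θ₁ (w / 2 + p.1 * w + p.2 * w) (w / 2 + p.1 * w)| :=
            abs_add_le _ _
        _ ≤ 2 * lam := by linarith [hQ.2.1, hQ.2.2]
  · intro p hp q hq hpq
    rw [Finset.mem_coe, Finset.mem_filter, Finset.mem_product, Finset.mem_range, hS, Finset.mem_filter,
      Finset.mem_range] at hp hq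
    simp only [Prod.mk.injEq] at hpq
    have hp1 := hp.1.2.1; have hq1 := hq.1.2.1
    have h2 : p.2 = q.2 := by omega
    have h1 : p.1 = q.1 := by omega
    exact Prod.ext h1 h2


/-! ## The grid counts: the anti-diagonal fibres and the depth -/

/-- **The count along one anti-diagonal** `(σ - t/2, σ + t/2)`, `t = (i+1) w ≤ τ` (lemma L5 with the
key bound `even_key`). [folklore] -/
theorem count_anti_sigma {θ₁ w δ lam τ η₀ σ : ℝ} (hw : 0 < w) (hδ : 0 ≤ δ) (hlam : 0 < lam) (hτ : 0 < τ)
    (hη₀ : 0 < η₀) (hδη : δ ≤ η₀ / 2) (hlo : a ≤ μ - η₀) (hhi : μ + η₀ ≤ b)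
    (hsmall : 2 * B.A2 * (η₀ / B.Dtmin + B.smax * (B.Cg * (lam + B.A2 * τ + 2 * B.smax * (η₀ / B.Dtmin)) + τ / 2)) ≤ B.hmin / 2) :
    ((((Finset.range ⌊τ / w⌋₊).filter fun i : ℕ =>
        |hfun μ θ₁ (σ - (w + i * w) / 2) (σ + (w + i * w) / 2)| ≤ δ ∧ |Gfun μ θ₁ σ (w + i * w)| ≤ 2 * lam).card : ℝ)) ≤
      (⌊τ / w⌋₊ * w / min (η₀ / (2 * (2 * B.A2) * τ)) (2 * lam / (8 * B.smax ^ 2 + 4 * B.A2)) + 1) *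
        (2 * ((if |hfun μ θ₁ σ σ| ≤ 2 * δ then 2 * Real.sqrt (δ / (B.hmin / 2))
          else 2 * δ * Real.sqrt (2 * (2 * B.A2)) / (B.hmin / 2 * Real.sqrt |hfun μ θ₁ σ σ|)) / w + 1)) := by
  obtain ⟨h1, h2⟩ := B.level hμ
  have hA := B.A2_pos; have hs := B.smax_pos; have hh := B.hmin_pos
  have h := gridCount_L5 (F := fun t => hfun μ θ₁ (σ - t / 2) (σ + t / 2))
    (F' := fun t => Real.sin (SX μ θ₁ (σ - t / 2) (σ + t / 2)) * (bandVX μ (σ + t / 2) - bandVX μ (σ - t / 2)) +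
        Real.sin (SY μ θ₁ (σ - t / 2) (σ + t / 2)) * (bandVY μ (σ + t / 2) - bandVY μ (σ - t / 2)))
    (G := fun t => Gfun μ θ₁ σ t) (hasDerivAt_hfun_anti h1 h2 θ₁ σ)
    (M := 2 * B.A2) (MG := 8 * B.smax ^ 2 + 4 * B.A2) (c := B.hmin / 2) (lam := lam) (η₀ := η₀) (τ := τ) (δ := δ)
    (by positivity) (by positivity) (by positivity) hlam hτ hη₀ hδ hδη
    (abs_anti_deriv_le B hμ θ₁ σ) (abs_Gfun_sub_le B hμ θ₁ σ)
    (fun t ht0 htτ hF hG => even_key B hμ ht0 htτ hlo hhi hF hG hsmall)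
    hw (K₀ := ⌊τ / w⌋₊) (by
      have := Nat.floor_le (div_nonneg hτ.le hw.le) (a := τ / w)
      rwa [le_div_iff₀ hw] at this)
  simp only [zero_div, sub_zero, add_zero] at h
  exact h

/-- **Level counts of the diagonal function** `H(σ) = h(σ, σ)` on the `σ`-grid `w/2 + s w/2`,
`s < 4N`: `#{|H| ≤ η} ≤ α η/w + β √η/w + γ` for every `η > 0` (lemma L4 below `η₀/2`, trivial above).
[folklore] -/
theorem count_levels_diag {θ₁ w η₀ η₁ η : ℝ} (hw : 0 < w) {N : ℕ} (hN : (N : ℝ) * w = 2 * π) (hη : 0 < η)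
    (hη₀ : 0 < η₀) (hη₁ : 0 < η₁) (hlo : a ≤ μ - η₀) (hhi : μ + η₀ ≤ b)
    (hsmallH : (16 * B.smax ^ 2 + 8 * B.A2) * (η₀ / B.Dtmin + B.smax * (B.Cg * (η₁ / 4 + 2 * B.smax * (η₀ / B.Dtmin)))) ≤ 2 * B.hmin) :
    ((((Finset.range (4 * N)).filter fun s : ℕ => |hfun μ θ₁ (w / 2 + s * (w / 2)) (w / 2 + s * (w / 2))| ≤ η).card : ℝ)) ≤
      (32 * (4 * π / min (η₀ / (2 * (8 * B.smax))) (η₁ / (4 * (16 * B.smax ^ 2 + 8 * B.A2))) + 1) / η₁ + 16 * π / η₀) * η / w +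
      (8 * (4 * π / min (η₀ / (2 * (8 * B.smax))) (η₁ / (4 * (16 * B.smax ^ 2 + 8 * B.A2))) + 1) / Real.sqrt (2 * B.hmin)) * Real.sqrt η / w +
      2 * (4 * π / min (η₀ / (2 * (8 * B.smax))) (η₁ / (4 * (16 * B.smax ^ 2 + 8 * B.A2))) + 1) := by
  obtain ⟨h1, h2⟩ := B.level hμ
  have hA := B.A2_pos; have hs := B.smax_pos; have hh := B.hmin_pos
  set ℓ₄ := min (η₀ / (2 * (8 * B.smax))) (η₁ / (4 * (16 * B.smax ^ 2 + 8 * B.A2))) with hℓ₄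
  have hℓ₄0 : 0 < ℓ₄ := lt_min (by positivity) (by positivity)
  set Q₄ := 4 * π / ℓ₄ + 1 with hQ₄
  have hQ₄0 : 0 < Q₄ := by positivity
  have h4N : ((4 * N : ℕ) : ℝ) * (w / 2) = 4 * π := by push_cast; linear_combination 2 * hN
  have hsq : 0 < Real.sqrt (2 * B.hmin) := Real.sqrt_pos.2 (by positivity)
  rcases le_or_gt η (η₀ / 2) with hle | hgt
  · have h := gridCount_L4 (g := fun x => hfun μ θ₁ x x)
      (g' := fun x => 4 * (Real.sin (SX μ θ₁ x x) * bandVX μ x + Real.sin (SY μ θ₁ x x) * bandVY μ x))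
      (g'' := fun x => 8 * (Real.cos (SX μ θ₁ x x) * bandVX μ x ^ 2 + Real.cos (SY μ θ₁ x x) * bandVY μ x ^ 2) +
        4 * (Real.sin (SX μ θ₁ x x) * bandAX μ x + Real.sin (SY μ θ₁ x x) * bandAY μ x))
      (hasDerivAt_hfun_diag_zero h1 h2 θ₁) (hasDerivAt_hfun_diag_zero_deriv h1 h2 θ₁)
      (M₁ := 8 * B.smax) (A := 16 * B.smax ^ 2 + 8 * B.A2) (η₀ := η₀) (η₁ := η₁) (c₂ := 2 * B.hmin) (δ := η)
      (by positivity) (by positivity) hη₀ hη₁ (by positivity) hη.le hle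
      (abs_diag_deriv_le B hμ θ₁) (abs_diag_deriv2_le B hμ θ₁)
      (fun z hz hz' => diag_strat B hμ hlo hhi hz hz' hsmallH) (x₀ := w / 2) (w := w / 2) (half_pos hw) (4 * N)
    rw [h4N] at h
    refine h.trans ?_
    have hmax : max (8 * η / η₁) (2 * Real.sqrt (η / (2 * B.hmin))) ≤ 8 * η / η₁ + 2 * (Real.sqrt η / Real.sqrt (2 * B.hmin)) := by
      rw [Real.sqrt_div hη.le]
      exact max_le (by linarith [div_nonneg (Real.sqrt_nonneg η) hsq.le]) (by linarith [div_nonneg (by linarith : 0 ≤ 8 * η) hη₁.le])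
    have hdiv : max (8 * η / η₁) (2 * Real.sqrt (η / (2 * B.hmin))) / (w / 2) ≤
        (8 * η / η₁ + 2 * (Real.sqrt η / Real.sqrt (2 * B.hmin))) / (w / 2) :=
      div_le_div_of_nonneg_right hmax (by positivity)
    have hQ : 4 * π / ℓ₄ + 1 = Q₄ := rfl
    rw [hQ]
    have e : Q₄ * (2 * ((8 * η / η₁ + 2 * (Real.sqrt η / Real.sqrt (2 * B.hmin))) / (w / 2) + 1)) =
        32 * Q₄ / η₁ * η / w + 8 * Q₄ / Real.sqrt (2 * B.hmin) * Real.sqrt η / w + 2 * Q₄ := by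
      field_simp; ring
    calc Q₄ * (2 * (max (8 * η / η₁) (2 * Real.sqrt (η / (2 * B.hmin))) / (w / 2) + 1))
        ≤ Q₄ * (2 * ((8 * η / η₁ + 2 * (Real.sqrt η / Real.sqrt (2 * B.hmin))) / (w / 2) + 1)) := by
          gcongr
      _ = 32 * Q₄ / η₁ * η / w + 8 * Q₄ / Real.sqrt (2 * B.hmin) * Real.sqrt η / w + 2 * Q₄ := e
      _ ≤ _ := by
          have t1 : 0 ≤ 16 * π / η₀ * η / w := by positivity
          have t2 : (32 * Q₄ / η₁ + 16 * π / η₀) * η / w = 32 * Q₄ / η₁ * η / w + 16 * π / η₀ * η / w := by ring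
          rw [t2]; linarith
  · -- trivial count
    have hcard : ((((Finset.range (4 * N)).filter fun s : ℕ =>
        |hfun μ θ₁ (w / 2 + s * (w / 2)) (w / 2 + s * (w / 2))| ≤ η).card : ℝ)) ≤ 8 * π / w := by
      calc _ ≤ (((Finset.range (4 * N)).card : ℝ)) := by exact_mod_cast Finset.card_filter_le _ _
        _ = 4 * N := by rw [Finset.card_range]; push_cast; ring
        _ = 8 * π / w := by field_simp; linear_combination 4 * hN
    have hb : 8 * π / w ≤ 16 * π / η₀ * η / w := by
      rw [div_le_div_iff_of_pos_right hw]
      rw [div_mul_eq_mul_div, le_div_iff₀ hη₀]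
      nlinarith [Real.pi_pos]
    have t1 : 0 ≤ 32 * Q₄ / η₁ * η / w := by positivity
    have t2 : 0 ≤ 8 * Q₄ / Real.sqrt (2 * B.hmin) * Real.sqrt η / w := by positivity
    have t3 : (32 * Q₄ / η₁ + 16 * π / η₀) * η / w = 32 * Q₄ / η₁ * η / w + 16 * π / η₀ * η / w := by ring
    rw [t3]
    linarith

omit B hμ in
set_option maxHeartbeats 800000 in
/-- **The dyadic total**: with level counts `#{v ≤ η} ≤ X η/w + Y √η/w + Z` (all `η > 0`),
`#T ≤ 8π/w`, `δ = C_δ w`, `w ≤ 1`, `2^J w = π`, the sum of the per-fibre widths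
`b_s = 2√(δ/c)` (`v_s ≤ 2δ`) / `2δ√(2M)/(c √v_s)` is at most `(J + 1) K_dy`. [folklore] -/
theorem dyadic_total {ι : Type*} (T : Finset ι) (v : ι → ℝ) {w Cδ c M X Y Z : ℝ} (hw : 0 < w) (hw1 : w ≤ 1)
    (hCδ : 0 < Cδ) (hc : 0 < c) (hM : 0 < M) (hX : 0 ≤ X) (hY : 0 ≤ Y) (hZ : 0 ≤ Z) {J : ℕ}
    (hJ : (2 : ℝ) ^ J * w = π) (hT : (T.card : ℝ) ≤ 8 * π / w)
    (hlevel : ∀ η : ℝ, 0 < η → (((T.filter fun s => v s ≤ η).card : ℝ)) ≤ X * η / w + Y * Real.sqrt η / w + Z) :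
    ∑ s ∈ T, (if v s ≤ 2 * (Cδ * w) then 2 * Real.sqrt (Cδ * w / c)
      else 2 * (Cδ * w) * Real.sqrt (2 * M) / (c * Real.sqrt (v s))) ≤
      ((J : ℝ) + 1) * (2 * Real.sqrt (Cδ / c) * (2 * X * Cδ + Y * Real.sqrt (2 * Cδ) + Z) +
        (2 * X * (2 * Cδ * Real.sqrt (2 * M) / c) * Real.sqrt (Cδ * π) +
          Real.sqrt 2 * Y * (2 * Cδ * Real.sqrt (2 * M) / c) + Z * (2 * Cδ * Real.sqrt (2 * M) / c) / Real.sqrt Cδ) +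
        8 * π * (2 * Cδ * Real.sqrt (2 * M) / c) / Real.sqrt (2 * Cδ * π)) := by
  set δ := Cδ * w with hδ
  have hδ0 : 0 < δ := by positivity
  set κ₁ := 2 * Cδ * Real.sqrt (2 * M) / c with hκ₁
  have hκ₁0 : 0 < κ₁ := by positivity
  set κ := 2 * δ * Real.sqrt (2 * M) / c with hκ
  have hκw : κ = κ₁ * w := by rw [hκ, hκ₁, hδ]; ring
  have hκ0 : 0 ≤ κ := by positivity
  set A₀ := 2 * Real.sqrt (δ / c) with hA₀
  have hA₀0 : 0 ≤ A₀ := by positivity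
  have hsw : Real.sqrt w ≤ 1 := by rw [← Real.sqrt_one]; exact Real.sqrt_le_sqrt hw1
  have hsw0 : 0 ≤ Real.sqrt w := Real.sqrt_nonneg _
  have hww : Real.sqrt w * Real.sqrt w = w := Real.mul_self_sqrt hw.le
  have hww2 : Real.sqrt w ^ 2 = w := Real.sq_sqrt hw.le
  -- rewrite the summand in the form of `dyadic_sum_le`
  have hsum : ∑ s ∈ T, (if v s ≤ 2 * δ then 2 * Real.sqrt (δ / c) else 2 * δ * Real.sqrt (2 * M) / (c * Real.sqrt (v s))) =
      ∑ s ∈ T, (if v s ≤ 2 * δ then A₀ else κ / Real.sqrt (v s)) := by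
    refine Finset.sum_congr rfl fun s _ => ?_
    split_ifs
    · rfl
    · rw [hκ]; field_simp
  rw [hsum]
  refine (dyadic_sum_le T v hδ0 hκ0 J).trans ?_
  -- term 0
  have hT0 : A₀ * (((T.filter fun s => v s ≤ 2 * δ).card : ℝ)) ≤
      2 * Real.sqrt (Cδ / c) * (2 * X * Cδ + Y * Real.sqrt (2 * Cδ) + Z) := by
    have hl := hlevel (2 * δ) (by positivity)
    have hA₀le : A₀ ≤ 2 * Real.sqrt (Cδ / c) := by
      rw [hA₀]; gcongr; rw [hδ]; nlinarith
    have hA₀eq : A₀ = 2 * Real.sqrt (Cδ / c) * Real.sqrt w := by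
      rw [hA₀, hδ, show Cδ * w / c = Cδ / c * w by ring, Real.sqrt_mul (div_nonneg hCδ.le hc.le)]; ring
    -- `A₀ · (X 2δ/w) = 2√(Cδ/c) √w · 2 X Cδ`, etc.
    have e1 : A₀ * (X * (2 * δ) / w) = 2 * Real.sqrt (Cδ / c) * (2 * X * Cδ) * Real.sqrt w := by
      rw [hA₀eq, hδ]; field_simp
    have e2 : A₀ * (Y * Real.sqrt (2 * δ) / w) = 2 * Real.sqrt (Cδ / c) * (Y * Real.sqrt (2 * Cδ)) := by
      rw [hA₀eq, hδ, show 2 * (Cδ * w) = 2 * Cδ * w by ring, Real.sqrt_mul (by positivity : (0:ℝ) ≤ 2 * Cδ)]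
      field_simp
      rw [hww2]; ring
    have e3 : A₀ * Z = 2 * Real.sqrt (Cδ / c) * Z * Real.sqrt w := by rw [hA₀eq]; ring
    calc A₀ * (((T.filter fun s => v s ≤ 2 * δ).card : ℝ)) ≤ A₀ * (X * (2 * δ) / w + Y * Real.sqrt (2 * δ) / w + Z) :=
          mul_le_mul_of_nonneg_left hl hA₀0
      _ = 2 * Real.sqrt (Cδ / c) * (2 * X * Cδ) * Real.sqrt w + 2 * Real.sqrt (Cδ / c) * (Y * Real.sqrt (2 * Cδ)) +
            2 * Real.sqrt (Cδ / c) * Z * Real.sqrt w := by rw [mul_add, mul_add, e1, e2, e3]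
      _ ≤ 2 * Real.sqrt (Cδ / c) * (2 * X * Cδ) * 1 + 2 * Real.sqrt (Cδ / c) * (Y * Real.sqrt (2 * Cδ)) +
            2 * Real.sqrt (Cδ / c) * Z * 1 := by
          gcongr
      _ = 2 * Real.sqrt (Cδ / c) * (2 * X * Cδ + Y * Real.sqrt (2 * Cδ) + Z) := by ring
  -- terms `1 ≤ j ≤ J`
  have hTj : ∀ j ∈ Finset.Icc 1 J, κ / Real.sqrt (2 ^ j * δ) * (((T.filter fun s => v s ≤ 2 ^ (j + 1) * δ).card : ℝ)) ≤
      2 * X * κ₁ * Real.sqrt (Cδ * π) + Real.sqrt 2 * Y * κ₁ + Z * κ₁ / Real.sqrt Cδ := by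
    intro j hj
    rw [Finset.mem_Icc] at hj
    have h2j : (0 : ℝ) < 2 ^ j := by positivity
    have hl := hlevel (2 ^ (j + 1) * δ) (by positivity)
    have hf0 : 0 ≤ κ / Real.sqrt (2 ^ j * δ) := by positivity
    have hsj : 0 < Real.sqrt (2 ^ j * δ) := Real.sqrt_pos.2 (by positivity)
    -- `f_j · X η_j / w = 2 X κ √(2^j δ) / w ≤ 2 X κ₁ √(Cδ π)`
    have e1 : κ / Real.sqrt (2 ^ j * δ) * (X * (2 ^ (j + 1) * δ) / w) = 2 * X * κ₁ * Real.sqrt (2 ^ j * δ) := by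
      have hS2 : Real.sqrt (2 ^ j * δ) * Real.sqrt (2 ^ j * δ) = 2 ^ j * δ := Real.mul_self_sqrt (by positivity)
      have hid : (2:ℝ) ^ (j + 1) * δ = 2 * Real.sqrt (2 ^ j * δ) * Real.sqrt (2 ^ j * δ) := by
        rw [mul_assoc, hS2, pow_succ]; ring
      rw [hκw, hid]
      field_simp
    have b1 : Real.sqrt (2 ^ j * δ) ≤ Real.sqrt (Cδ * π) := by
      apply Real.sqrt_le_sqrt
      rw [hδ, ← hJ]
      have : (2:ℝ) ^ j ≤ 2 ^ J := pow_le_pow_right₀ (by norm_num) hj.2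
      nlinarith
    -- `f_j · Y √η_j / w = √2 Y κ₁`
    have e2 : κ / Real.sqrt (2 ^ j * δ) * (Y * Real.sqrt (2 ^ (j + 1) * δ) / w) = Real.sqrt 2 * Y * κ₁ := by
      rw [pow_succ, show (2:ℝ) ^ j * 2 * δ = 2 * (2 ^ j * δ) by ring, Real.sqrt_mul (by norm_num : (0:ℝ) ≤ 2), hκw]
      field_simp
    -- `f_j · Z ≤ Z κ₁ / √Cδ`
    have e3 : κ / Real.sqrt (2 ^ j * δ) * Z ≤ Z * κ₁ / Real.sqrt Cδ := by
      have hCs : 0 < Real.sqrt Cδ := Real.sqrt_pos.2 hCδ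
      -- `κ / √(2^j δ) ≤ κ / √δ = κ₁ w / (√Cδ √w) = κ₁ √w / √Cδ ≤ κ₁ / √Cδ`
      have s1 : κ / Real.sqrt (2 ^ j * δ) ≤ κ / Real.sqrt δ := by
        apply div_le_div_of_nonneg_left hκ0 (Real.sqrt_pos.2 hδ0)
        apply Real.sqrt_le_sqrt
        have : (1:ℝ) ≤ 2 ^ j := one_le_pow₀ (by norm_num)
        nlinarith
      have s2 : κ / Real.sqrt δ = κ₁ * Real.sqrt w / Real.sqrt Cδ := by
        rw [hκw, hδ, Real.sqrt_mul hCδ.le]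
        field_simp
        rw [hww2]
      have s3 : κ₁ * Real.sqrt w / Real.sqrt Cδ ≤ κ₁ / Real.sqrt Cδ := by
        apply div_le_div_of_nonneg_right _ hCs.le
        calc κ₁ * Real.sqrt w ≤ κ₁ * 1 := mul_le_mul_of_nonneg_left hsw hκ₁0.le
          _ = κ₁ := mul_one _
      calc κ / Real.sqrt (2 ^ j * δ) * Z ≤ κ₁ / Real.sqrt Cδ * Z :=
            mul_le_mul_of_nonneg_right (s1.trans (s2.le.trans s3)) hZ
        _ = Z * κ₁ / Real.sqrt Cδ := by ring
    calc κ / Real.sqrt (2 ^ j * δ) * (((T.filter fun s => v s ≤ 2 ^ (j + 1) * δ).card : ℝ))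
        ≤ κ / Real.sqrt (2 ^ j * δ) * (X * (2 ^ (j + 1) * δ) / w + Y * Real.sqrt (2 ^ (j + 1) * δ) / w + Z) :=
          mul_le_mul_of_nonneg_left hl hf0
      _ = 2 * X * κ₁ * Real.sqrt (2 ^ j * δ) + Real.sqrt 2 * Y * κ₁ + κ / Real.sqrt (2 ^ j * δ) * Z := by
          rw [mul_add, mul_add, e1, e2]
      _ ≤ 2 * X * κ₁ * Real.sqrt (Cδ * π) + Real.sqrt 2 * Y * κ₁ + Z * κ₁ / Real.sqrt Cδ := by
          have : 2 * X * κ₁ * Real.sqrt (2 ^ j * δ) ≤ 2 * X * κ₁ * Real.sqrt (Cδ * π) :=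
            mul_le_mul_of_nonneg_left b1 (by positivity)
          linarith
  -- tail
  have htail : (T.card : ℝ) * (κ / Real.sqrt (2 ^ (J + 1) * δ)) ≤ 8 * π * κ₁ / Real.sqrt (2 * Cδ * π) := by
    have e : 2 ^ (J + 1) * δ = 2 * Cδ * π := by rw [hδ, pow_succ, ← hJ]; ring
    rw [e, hκw]
    have hsp : 0 < Real.sqrt (2 * Cδ * π) := Real.sqrt_pos.2 (by positivity)
    calc (T.card : ℝ) * (κ₁ * w / Real.sqrt (2 * Cδ * π)) ≤ (8 * π / w) * (κ₁ * w / Real.sqrt (2 * Cδ * π)) :=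
          mul_le_mul_of_nonneg_right hT (by positivity)
      _ = 8 * π * κ₁ / Real.sqrt (2 * Cδ * π) := by field_simp
  -- assemble
  have hmid : ∑ j ∈ Finset.Icc 1 J, κ / Real.sqrt (2 ^ j * δ) * (((T.filter fun s => v s ≤ 2 ^ (j + 1) * δ).card : ℝ)) ≤
      J * (2 * X * κ₁ * Real.sqrt (Cδ * π) + Real.sqrt 2 * Y * κ₁ + Z * κ₁ / Real.sqrt Cδ) := by
    calc _ ≤ ∑ j ∈ Finset.Icc 1 J, (2 * X * κ₁ * Real.sqrt (Cδ * π) + Real.sqrt 2 * Y * κ₁ + Z * κ₁ / Real.sqrt Cδ) :=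
          Finset.sum_le_sum hTj
      _ = _ := by rw [Finset.sum_const, Nat.card_Icc, Nat.add_sub_cancel, nsmul_eq_mul]
  have hK1 : 0 ≤ 2 * Real.sqrt (Cδ / c) * (2 * X * Cδ + Y * Real.sqrt (2 * Cδ) + Z) := by positivity
  have hK2 : 0 ≤ 2 * X * κ₁ * Real.sqrt (Cδ * π) + Real.sqrt 2 * Y * κ₁ + Z * κ₁ / Real.sqrt Cδ := by positivity
  have hK3 : 0 ≤ 8 * π * κ₁ / Real.sqrt (2 * Cδ * π) := by positivity
  have hJ0 : (0 : ℝ) ≤ J := by positivity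
  have hJK1 := mul_nonneg hJ0 hK1
  have hJK3 := mul_nonneg hJ0 hK3
  nlinarith [hT0, hmid, htail, hJK1, hJK3, hK2]


/-! ## The grid counts: everything together -/

/-- **Sum of the anti-diagonal counts** over the `σ`-grid, through the dyadic depth argument:
`Σ_{s<4N} E(s) ≤ (τ/ℓ₅ + 1)·2·((J+1) K_dy / w + 4N)`. [folklore] -/
theorem count_anti_total {θ₁ w Cδ lam τ η₀ η₁ : ℝ} (hw : 0 < w) (hw1 : w ≤ 1) {N J : ℕ} (hN : (N : ℝ) * w = 2 * π)
    (hJ : (2 : ℝ) ^ J * w = π) (hCδ : 0 < Cδ) (hlam : 0 < lam) (hτ : 0 < τ) (hη₀ : 0 < η₀) (hη₁ : 0 < η₁)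
    (h2δ : Cδ * w ≤ η₀ / 2) (hlo : a ≤ μ - η₀) (hhi : μ + η₀ ≤ b)
    (heven : 2 * B.A2 * (η₀ / B.Dtmin + B.smax * (B.Cg * (lam + B.A2 * τ + 2 * B.smax * (η₀ / B.Dtmin)) + τ / 2)) ≤ B.hmin / 2)
    (hH : (16 * B.smax ^ 2 + 8 * B.A2) * (η₀ / B.Dtmin + B.smax * (B.Cg * (η₁ / 4 + 2 * B.smax * (η₀ / B.Dtmin)))) ≤ 2 * B.hmin) :
    ∑ s ∈ Finset.range (4 * N), ((((Finset.range ⌊τ / w⌋₊).filter fun i : ℕ =>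
        |hfun μ θ₁ (w / 2 + s * (w / 2) - (w + i * w) / 2) (w / 2 + s * (w / 2) + (w + i * w) / 2)| ≤ Cδ * w ∧
        |Gfun μ θ₁ (w / 2 + s * (w / 2)) (w + i * w)| ≤ 2 * lam).card : ℝ)) ≤
      (τ / min (η₀ / (2 * (2 * B.A2) * τ)) (2 * lam / (8 * B.smax ^ 2 + 4 * B.A2)) + 1) * (2 *
        (((J : ℝ) + 1) * (2 * Real.sqrt (Cδ / (B.hmin / 2)) *
            (2 * (32 * (4 * π / min (η₀ / (2 * (8 * B.smax))) (η₁ / (4 * (16 * B.smax ^ 2 + 8 * B.A2))) + 1) / η₁ + 16 * π / η₀) * Cδ +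
              (8 * (4 * π / min (η₀ / (2 * (8 * B.smax))) (η₁ / (4 * (16 * B.smax ^ 2 + 8 * B.A2))) + 1) / Real.sqrt (2 * B.hmin)) * Real.sqrt (2 * Cδ) +
              2 * (4 * π / min (η₀ / (2 * (8 * B.smax))) (η₁ / (4 * (16 * B.smax ^ 2 + 8 * B.A2))) + 1)) +
          (2 * (32 * (4 * π / min (η₀ / (2 * (8 * B.smax))) (η₁ / (4 * (16 * B.smax ^ 2 + 8 * B.A2))) + 1) / η₁ + 16 * π / η₀) *
              (2 * Cδ * Real.sqrt (2 * (2 * B.A2)) / (B.hmin / 2)) * Real.sqrt (Cδ * π) +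
            Real.sqrt 2 * (8 * (4 * π / min (η₀ / (2 * (8 * B.smax))) (η₁ / (4 * (16 * B.smax ^ 2 + 8 * B.A2))) + 1) / Real.sqrt (2 * B.hmin)) *
              (2 * Cδ * Real.sqrt (2 * (2 * B.A2)) / (B.hmin / 2)) +
            2 * (4 * π / min (η₀ / (2 * (8 * B.smax))) (η₁ / (4 * (16 * B.smax ^ 2 + 8 * B.A2))) + 1) *
              (2 * Cδ * Real.sqrt (2 * (2 * B.A2)) / (B.hmin / 2)) / Real.sqrt Cδ) +
          8 * π * (2 * Cδ * Real.sqrt (2 * (2 * B.A2)) / (B.hmin / 2)) / Real.sqrt (2 * Cδ * π)) / w + 4 * N)) := by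
  have hA := B.A2_pos; have hs := B.smax_pos; have hh := B.hmin_pos
  set Q₄ := 4 * π / min (η₀ / (2 * (8 * B.smax))) (η₁ / (4 * (16 * B.smax ^ 2 + 8 * B.A2))) + 1 with hQ₄
  have hℓ₄ : 0 < min (η₀ / (2 * (8 * B.smax))) (η₁ / (4 * (16 * B.smax ^ 2 + 8 * B.A2))) := lt_min (by positivity) (by positivity)
  have hQ₄0 : 0 < Q₄ := by positivity
  set X := 32 * Q₄ / η₁ + 16 * π / η₀ with hX
  set Y := 8 * Q₄ / Real.sqrt (2 * B.hmin) with hY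
  set Z := 2 * Q₄ with hZ
  have hX0 : 0 ≤ X := by positivity
  have hY0 : 0 ≤ Y := by positivity
  have hZ0 : 0 ≤ Z := by positivity
  set ℓ₅ := min (η₀ / (2 * (2 * B.A2) * τ)) (2 * lam / (8 * B.smax ^ 2 + 4 * B.A2)) with hℓ₅
  have hℓ₅0 : 0 < ℓ₅ := lt_min (by positivity) (by positivity)
  set K₀ := ⌊τ / w⌋₊ with hK₀
  have hK₀τ : (K₀ : ℝ) * w ≤ τ := by
    have := Nat.floor_le (div_nonneg hτ.le hw.le) (a := τ / w)
    rwa [le_div_iff₀ hw] at this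
  set bσ : ℕ → ℝ := fun s =>
    if |hfun μ θ₁ (w / 2 + s * (w / 2)) (w / 2 + s * (w / 2))| ≤ 2 * (Cδ * w) then 2 * Real.sqrt (Cδ * w / (B.hmin / 2))
    else 2 * (Cδ * w) * Real.sqrt (2 * (2 * B.A2)) / (B.hmin / 2 * Real.sqrt |hfun μ θ₁ (w / 2 + s * (w / 2)) (w / 2 + s * (w / 2))|) with hbσ
  -- per-fibre bound
  have hper : ∀ s ∈ Finset.range (4 * N), ((((Finset.range K₀).filter fun i : ℕ =>
        |hfun μ θ₁ (w / 2 + s * (w / 2) - (w + i * w) / 2) (w / 2 + s * (w / 2) + (w + i * w) / 2)| ≤ Cδ * w ∧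
        |Gfun μ θ₁ (w / 2 + s * (w / 2)) (w + i * w)| ≤ 2 * lam).card : ℝ)) ≤
      (τ / ℓ₅ + 1) * (2 * (bσ s / w + 1)) := by
    intro s _
    have h := count_anti_sigma B hμ (θ₁ := θ₁) (σ := w / 2 + s * (w / 2)) hw (by positivity) hlam hτ hη₀ h2δ hlo hhi heven
    refine h.trans ?_
    have hb0 : 0 ≤ bσ s := by rw [hbσ]; dsimp only; split_ifs <;> positivity
    have hfac : (K₀ : ℝ) * w / ℓ₅ + 1 ≤ τ / ℓ₅ + 1 := by
      have := div_le_div_of_nonneg_right hK₀τ hℓ₅0.le; linarith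
    exact mul_le_mul_of_nonneg_right hfac (by positivity)
  -- the dyadic total
  have hT : (((Finset.range (4 * N)).card : ℝ)) ≤ 8 * π / w := by
    rw [Finset.card_range]; push_cast
    rw [le_div_iff₀ hw]; nlinarith
  have hdy := dyadic_total (Finset.range (4 * N)) (fun s : ℕ => |hfun μ θ₁ (w / 2 + s * (w / 2)) (w / 2 + s * (w / 2))|)
    hw hw1 hCδ (half_pos hh) (by positivity : (0:ℝ) < 2 * B.A2) hX0 hY0 hZ0 hJ hT
    (fun η hη => count_levels_diag B hμ (θ₁ := θ₁) hw hN hη hη₀ hη₁ hlo hhi hH)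
  -- sum the per-fibre bounds
  calc _ ≤ ∑ s ∈ Finset.range (4 * N), (τ / ℓ₅ + 1) * (2 * (bσ s / w + 1)) := Finset.sum_le_sum hper
    _ = (τ / ℓ₅ + 1) * (2 * ((∑ s ∈ Finset.range (4 * N), bσ s) / w + 4 * N)) := by
        rw [← Finset.mul_sum, ← Finset.mul_sum, Finset.sum_add_distrib, Finset.sum_div, Finset.sum_const,
          Finset.card_range]
        simp
    _ ≤ _ := by
        apply mul_le_mul_of_nonneg_left _ (by positivity)
        apply mul_le_mul_of_nonneg_left _ (by norm_num)
        exact add_le_add (div_le_div_of_nonneg_right hdy hw.le) le_rfl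


omit hμ in
set_option maxHeartbeats 1600000 in
/-- **The two-dimensional count**: for constants chosen small in terms of the uniform bounds `B`,
there is `K_p` with `#{(a, c) : |h(θ_a, θ_c)| ≤ C_δ w} ≤ K_p (J + 2 + log N)/w` on every grid
`N w = 2π`, `2^J w = π`, uniformly in the level `μ` (with margin `η₀`) and in `θ₁`. [folklore] -/
theorem count_pairs_exists {Cδ τ lam ηo η₀ η₁ : ℝ} (hCδ : 0 < Cδ) (hτ : 0 < τ) (hτπ : τ < π) (hlam : 0 < lam)
    (hηo : 0 < ηo) (hη₀ : 0 < η₀) (hη₁ : 0 < η₁)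
    (hcov : 2 * (B.Cg * (lam / 2 + 2 * B.smax * (η₀ / B.Dtmin))) ≤ τ)
    (hodd : 4 * B.A2 * B.smax * (2 * τ + 2 * B.Cg * B.smax ^ 2 * τ + B.Cg * (ηo / 2)) ≤ B.hmin)
    (heven : 2 * B.A2 * (η₀ / B.Dtmin + B.smax * (B.Cg * (lam + B.A2 * τ + 2 * B.smax * (η₀ / B.Dtmin)) + τ / 2)) ≤ B.hmin / 2)
    (hH : (16 * B.smax ^ 2 + 8 * B.A2) * (η₀ / B.Dtmin + B.smax * (B.Cg * (η₁ / 4 + 2 * B.smax * (η₀ / B.Dtmin)))) ≤ 2 * B.hmin) :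
    ∃ Kp : ℝ, 0 < Kp ∧ ∀ μ : ℝ, μ ∈ Icc a b → a ≤ μ - η₀ → μ + η₀ ≤ b →
      ∀ (θ₁ w : ℝ) (N Nh J : ℕ), 0 < w → w ≤ 1 → (N : ℝ) * w = 2 * π → (Nh : ℝ) * w = π → N = 2 * Nh →
        (2 : ℝ) ^ J * w = π → Cδ * w ≤ η₀ / 2 →
        ((((Finset.range N ×ˢ Finset.range N).filter fun p : ℕ × ℕ =>
            |hfun μ θ₁ (w / 2 + p.1 * w) (w / 2 + p.2 * w)| ≤ Cδ * w).card : ℝ)) ≤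
          Kp * ((J : ℝ) + 2 + Real.log N) / w := by
  have hA := B.A2_pos; have hs := B.smax_pos; have hh := B.hmin_pos; have hCg := B.Cg_pos; have hDt := B.Dtmin_pos
  have hπ := Real.pi_pos
  -- the big constants
  obtain ⟨Kdy, hKdy⟩ : ∃ Kdy : ℝ, Kdy = 2 * Real.sqrt (Cδ / (B.hmin / 2)) *
          (2 * (32 * (4 * π / min (η₀ / (2 * (8 * B.smax))) (η₁ / (4 * (16 * B.smax ^ 2 + 8 * B.A2))) + 1) / η₁ + 16 * π / η₀) * Cδ +
            (8 * (4 * π / min (η₀ / (2 * (8 * B.smax))) (η₁ / (4 * (16 * B.smax ^ 2 + 8 * B.A2))) + 1) / Real.sqrt (2 * B.hmin)) * Real.sqrt (2 * Cδ) +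
            2 * (4 * π / min (η₀ / (2 * (8 * B.smax))) (η₁ / (4 * (16 * B.smax ^ 2 + 8 * B.A2))) + 1)) +
        (2 * (32 * (4 * π / min (η₀ / (2 * (8 * B.smax))) (η₁ / (4 * (16 * B.smax ^ 2 + 8 * B.A2))) + 1) / η₁ + 16 * π / η₀) *
            (2 * Cδ * Real.sqrt (2 * (2 * B.A2)) / (B.hmin / 2)) * Real.sqrt (Cδ * π) +
          Real.sqrt 2 * (8 * (4 * π / min (η₀ / (2 * (8 * B.smax))) (η₁ / (4 * (16 * B.smax ^ 2 + 8 * B.A2))) + 1) / Real.sqrt (2 * B.hmin)) *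
            (2 * Cδ * Real.sqrt (2 * (2 * B.A2)) / (B.hmin / 2)) +
          2 * (4 * π / min (η₀ / (2 * (8 * B.smax))) (η₁ / (4 * (16 * B.smax ^ 2 + 8 * B.A2))) + 1) *
            (2 * Cδ * Real.sqrt (2 * (2 * B.A2)) / (B.hmin / 2)) / Real.sqrt Cδ) +
        8 * π * (2 * Cδ * Real.sqrt (2 * (2 * B.A2)) / (B.hmin / 2)) / Real.sqrt (2 * Cδ * π) := ⟨_, rfl⟩
  obtain ⟨F₅, hF₅⟩ : ∃ F₅ : ℝ, F₅ = τ / min (η₀ / (2 * (2 * B.A2) * τ)) (2 * lam / (8 * B.smax ^ 2 + 4 * B.A2)) + 1 := ⟨_, rfl⟩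
  obtain ⟨C₅, hC₅⟩ : ∃ C₅ : ℝ, C₅ = 2 * π / (ηo / (8 * B.A2)) + 1 := ⟨_, rfl⟩
  obtain ⟨C₃', hC₃'⟩ : ∃ C₃' : ℝ, C₃' = (2 * π / (lam / (2 * (4 * B.smax ^ 2 + 4 * B.A2))) + 1) * (2 * (4 * Cδ / lam + 1)) := ⟨_, rfl⟩
  have hℓ₄ : 0 < min (η₀ / (2 * (8 * B.smax))) (η₁ / (4 * (16 * B.smax ^ 2 + 8 * B.A2))) := lt_min (by positivity) (by positivity)
  have hℓ₅ : 0 < min (η₀ / (2 * (2 * B.A2) * τ)) (2 * lam / (8 * B.smax ^ 2 + 4 * B.A2)) := lt_min (by positivity) (by positivity)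
  have hKdy0 : 0 ≤ Kdy := by rw [hKdy]; positivity
  have hF₅0 : 0 ≤ F₅ := by rw [hF₅]; positivity
  have hC₅0 : 0 ≤ C₅ := by rw [hC₅]; positivity
  have hC₃'0 : 0 ≤ C₃' := by rw [hC₃']; positivity
  refine ⟨4 * π * C₃' + (2 * π + 2 * (F₅ * (2 * (Kdy + 8 * π)))) +
      (2 * π * (2 * (2 * Cδ / ηo) + 1) + 2 * C₅ * (2 * Cδ / B.hmin * 2 + 2 * π)), by positivity,
    fun μ hμ hlo hhi θ₁ w N Nh J hw hw1 hN hNh hNN hJ h2δ => ?_⟩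
  obtain ⟨h1, h2⟩ := B.level hμ
  have hδη : Cδ * w ≤ η₀ := by linarith only [h2δ, hη₀]
  have hδ0 : 0 ≤ Cδ * w := by positivity
  have hN0 : (0 : ℝ) < N := by
    have : (0:ℝ) < N * w := by rw [hN]; positivity
    exact pos_of_mul_pos_left this hw.le
  have hNpos : 0 < N := Nat.pos_of_ne_zero (fun h0 => by rw [h0] at hN0; simp at hN0)
  have hN1 : (1 : ℝ) ≤ N := by exact_mod_cast hNpos
  have hlog : 0 ≤ Real.log N := Real.log_nonneg hN1
  have hJ0 : (0 : ℝ) ≤ J := by positivity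
  -- the three families of pairs
  set S := Finset.range N ×ˢ Finset.range N with hS
  set P := S.filter (fun p : ℕ × ℕ => |hfun μ θ₁ (w / 2 + p.1 * w) (w / 2 + p.2 * w)| ≤ Cδ * w) with hP
  set P₃ := S.filter (fun p : ℕ × ℕ => |hfun μ θ₁ (w / 2 + p.1 * w) (w / 2 + p.2 * w)| ≤ Cδ * w ∧
    lam ≤ |h3 μ θ₁ (w / 2 + p.1 * w) (w / 2 + p.2 * w)|) with hP₃
  set P₂ := S.filter (fun p : ℕ × ℕ => |hfun μ θ₁ (w / 2 + p.1 * w) (w / 2 + p.2 * w)| ≤ Cδ * w ∧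
    lam ≤ |h3 μ θ₁ (w / 2 + p.2 * w) (w / 2 + p.1 * w)|) with hP₂
  set P₀ := S.filter (fun p : ℕ × ℕ => |hfun μ θ₁ (w / 2 + p.1 * w) (w / 2 + p.2 * w)| ≤ Cδ * w ∧
    |h3 μ θ₁ (w / 2 + p.1 * w) (w / 2 + p.2 * w)| < lam ∧ |h3 μ θ₁ (w / 2 + p.2 * w) (w / 2 + p.1 * w)| < lam) with hP₀
  have hsub : P ⊆ P₃ ∪ (P₂ ∪ P₀) := by
    intro p hp
    rw [hP, Finset.mem_filter] at hp
    rw [Finset.mem_union, Finset.mem_union, hP₃, hP₂, hP₀, Finset.mem_filter, Finset.mem_filter, Finset.mem_filter]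
    by_cases h3a : lam ≤ |h3 μ θ₁ (w / 2 + p.1 * w) (w / 2 + p.2 * w)|
    · exact Or.inl ⟨hp.1, hp.2, h3a⟩
    · by_cases h3b : lam ≤ |h3 μ θ₁ (w / 2 + p.2 * w) (w / 2 + p.1 * w)|
      · exact Or.inr (Or.inl ⟨hp.1, hp.2, h3b⟩)
      · exact Or.inr (Or.inr ⟨hp.1, hp.2, not_le.1 h3a, not_le.1 h3b⟩)
  have hcardP : (P.card : ℝ) ≤ (P₃.card : ℝ) + (P₂.card : ℝ) + (P₀.card : ℝ) := by
    have e1 := Finset.card_le_card hsub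
    have e2 := Finset.card_union_le P₃ (P₂ ∪ P₀)
    have e3 := Finset.card_union_le P₂ P₀
    have : P.card ≤ P₃.card + P₂.card + P₀.card := by omega
    exact_mod_cast this
  -- the transversal families
  have hC₃eq : (2 * π / (lam / (2 * (4 * B.smax ^ 2 + 4 * B.A2))) + 1) * (2 * ((4 * (Cδ * w) / lam) / w + 1)) = C₃' := by
    rw [hC₃']; congr 2; field_simp
  have hP₃ : (P₃.card : ℝ) ≤ N * C₃' := by
    calc (P₃.card : ℝ) = ∑ i ∈ Finset.range N, ((((Finset.range N).filter fun c : ℕ =>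
          |hfun μ θ₁ (w / 2 + i * w) (w / 2 + c * w)| ≤ Cδ * w ∧ lam ≤ |h3 μ θ₁ (w / 2 + i * w) (w / 2 + c * w)|).card : ℝ)) :=
          card_filter_prod_eq_sum N (fun i c : ℕ => |hfun μ θ₁ (w / 2 + i * w) (w / 2 + c * w)| ≤ Cδ * w ∧
            lam ≤ |h3 μ θ₁ (w / 2 + i * w) (w / 2 + c * w)|)
      _ ≤ N * ((2 * π / (lam / (2 * (4 * B.smax ^ 2 + 4 * B.A2))) + 1) * (2 * ((4 * (Cδ * w) / lam) / w + 1))) :=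
          count_transversal B hμ hw hlam hδ0 hN
      _ = N * C₃' := by rw [hC₃eq]
  have hP₂ : (P₂.card : ℝ) ≤ N * C₃' := by
    calc (P₂.card : ℝ) = ∑ c ∈ Finset.range N, ((((Finset.range N).filter fun i : ℕ =>
          |hfun μ θ₁ (w / 2 + i * w) (w / 2 + c * w)| ≤ Cδ * w ∧ lam ≤ |h3 μ θ₁ (w / 2 + c * w) (w / 2 + i * w)|).card : ℝ)) :=
          card_filter_prod_eq_sum' N (fun i c : ℕ => |hfun μ θ₁ (w / 2 + i * w) (w / 2 + c * w)| ≤ Cδ * w ∧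
            lam ≤ |h3 μ θ₁ (w / 2 + c * w) (w / 2 + i * w)|)
      _ ≤ N * ((2 * π / (lam / (2 * (4 * B.smax ^ 2 + 4 * B.A2))) + 1) * (2 * ((4 * (Cδ * w) / lam) / w + 1))) :=
          count_transversal' B hμ hw hlam hδ0 hN
      _ = N * C₃' := by rw [hC₃eq]
  -- the family with both partials small
  set f : ℕ → ℝ := fun k => ((((Finset.range N).filter fun i : ℕ =>
      |hfun μ θ₁ (w / 2 + i * w) (w / 2 + i * w + k * w)| ≤ Cδ * w ∧
      |h3 μ θ₁ (w / 2 + i * w) (w / 2 + i * w + k * w)| < lam ∧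
      |h3 μ θ₁ (w / 2 + i * w + k * w) (w / 2 + i * w)| < lam).card : ℝ)) with hf
  have hP₀ : (P₀.card : ℝ) ≤ ∑ k ∈ Finset.range N, f k := count_reindex B hμ hN
  have hf0 : ∀ k, 0 ≤ f k := fun k => by positivity
  have hsplit := sum_split_three (N := N) f (fun k : ℕ => (k : ℝ) * w ≤ τ) (fun k : ℕ => |(k : ℝ) * w - π| ≤ τ)
    (fun k : ℕ => 2 * π - τ ≤ (k : ℝ) * w) hf0 (by
      intro k hk hfk
      rw [Finset.mem_range] at hk
      have hne : ((Finset.range N).filter fun i : ℕ =>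
          |hfun μ θ₁ (w / 2 + i * w) (w / 2 + i * w + k * w)| ≤ Cδ * w ∧
          |h3 μ θ₁ (w / 2 + i * w) (w / 2 + i * w + k * w)| < lam ∧
          |h3 μ θ₁ (w / 2 + i * w + k * w) (w / 2 + i * w)| < lam).Nonempty := by
        rw [← Finset.card_pos]
        by_contra h0
        push Not at h0
        have : f k = 0 := by rw [hf]; dsimp only; exact_mod_cast Nat.le_zero.1 h0
        exact hfk this
      obtain ⟨i, hi⟩ := hne
      rw [Finset.mem_filter] at hi
      exact krange B hμ hw hN hk hτπ hlo hhi hδη hcov hi.2)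
  have hA' := count_even_pos (μ := μ) (θ₁ := θ₁) (δ := Cδ * w) (lam := lam) (τ := τ) hw (N := N)
  have hBo : ∑ k ∈ (Finset.range N).filter (fun k : ℕ => |(k : ℝ) * w - π| ≤ τ), f k ≤
      N * (2 * (2 * (Cδ * w) / (ηo * w)) + 1) + 2 * C₅ * ((2 * (Cδ * w) / (B.hmin * w)) * (2 * (1 + Real.log N)) / w + N) := by
    have := count_odd_total B hμ (θ₁ := θ₁) (δ := Cδ * w) (lam := lam) (τ := τ) hw hN hNh hNN (by positivity) hηo hodd
    rw [← hC₅] at this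
    exact this
  have hC' := count_even_neg B hμ (θ₁ := θ₁) (δ := Cδ * w) (lam := lam) (τ := τ) hw hN
  have hE : ∑ s ∈ Finset.range (4 * N), ((((Finset.range ⌊τ / w⌋₊).filter fun i : ℕ =>
      |hfun μ θ₁ (w / 2 + s * (w / 2) - (w + i * w) / 2) (w / 2 + s * (w / 2) + (w + i * w) / 2)| ≤ Cδ * w ∧
      |Gfun μ θ₁ (w / 2 + s * (w / 2)) (w + i * w)| ≤ 2 * lam).card : ℝ)) ≤ F₅ * (2 * (((J : ℝ) + 1) * Kdy / w + 4 * N)) := by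
    have := count_anti_total B hμ (θ₁ := θ₁) hw hw1 hN hJ hCδ hlam hτ hη₀ hη₁ h2δ hlo hhi heven hH
    rw [← hKdy, ← hF₅] at this
    exact this
  clear hKdy hF₅ hC₅ hC₃' hC₃eq
  -- abbreviate the logarithm and the sums, and use `N = 2π/w`
  set lg := Real.log (N : ℝ) with hlg
  set L := (J : ℝ) + 2 + lg with hL
  have hL1 : 1 ≤ L := by rw [hL]; linarith only [hlog, hJ0]
  have hNw : (N : ℝ) = 2 * π / w := by field_simp; linarith only [hN]
  set EE := ∑ s ∈ Finset.range (4 * N), ((((Finset.range ⌊τ / w⌋₊).filter fun i : ℕ =>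
      |hfun μ θ₁ (w / 2 + s * (w / 2) - (w + i * w) / 2) (w / 2 + s * (w / 2) + (w + i * w) / 2)| ≤ Cδ * w ∧
      |Gfun μ θ₁ (w / 2 + s * (w / 2)) (w + i * w)| ≤ 2 * lam).card : ℝ)) with hEE
  set OD := ∑ k ∈ (Finset.range N).filter (fun k : ℕ => |(k : ℝ) * w - π| ≤ τ), f k with hOD
  have hEB : EE ≤ F₅ * (2 * (Kdy + 8 * π)) * L / w := by
    refine hE.trans ?_
    have h4N : (4 : ℝ) * N = 8 * π / w := by rw [hNw]; ring
    have key : ((J : ℝ) + 1) * Kdy + 8 * π ≤ (Kdy + 8 * π) * L := by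
      rw [hL]; nlinarith only [hlog, hKdy0, hπ, hJ0]
    calc F₅ * (2 * (((J : ℝ) + 1) * Kdy / w + 4 * N)) = F₅ * (2 * ((((J : ℝ) + 1) * Kdy + 8 * π) / w)) := by
          rw [h4N, add_div]
      _ = F₅ * 2 * (((J : ℝ) + 1) * Kdy + 8 * π) / w := by ring
      _ ≤ F₅ * 2 * ((Kdy + 8 * π) * L) / w := by gcongr
      _ = F₅ * (2 * (Kdy + 8 * π)) * L / w := by ring
  have hodd' : OD ≤ (2 * π * (2 * (2 * Cδ / ηo) + 1) + 2 * C₅ * (2 * Cδ / B.hmin * 2 + 2 * π)) * L / w := by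
    refine hBo.trans ?_
    have e1 : 2 * (Cδ * w) / (ηo * w) = 2 * Cδ / ηo := by field_simp
    have e2 : 2 * (Cδ * w) / (B.hmin * w) = 2 * Cδ / B.hmin := by field_simp
    rw [e1, e2, hNw]
    have t1 : 1 + lg ≤ L := by rw [hL]; linarith only [hJ0]
    have t2 : 0 ≤ 2 * Cδ / B.hmin := by positivity
    have t3 : 0 ≤ 2 * π * (2 * (2 * Cδ / ηo) + 1) := by positivity
    have key : 2 * π * (2 * (2 * Cδ / ηo) + 1) + 2 * C₅ * (2 * Cδ / B.hmin * (2 * (1 + lg)) + 2 * π) ≤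
        (2 * π * (2 * (2 * Cδ / ηo) + 1) + 2 * C₅ * (2 * Cδ / B.hmin * 2 + 2 * π)) * L := by
      have f1 : 2 * π * (2 * (2 * Cδ / ηo) + 1) ≤ 2 * π * (2 * (2 * Cδ / ηo) + 1) * L := le_mul_of_one_le_right t3 hL1
      have f2 : 2 * Cδ / B.hmin * (2 * (1 + lg)) ≤ 2 * Cδ / B.hmin * (2 * L) :=
        mul_le_mul_of_nonneg_left (by linarith only [t1]) t2
      have f3 : 2 * π ≤ 2 * π * L := le_mul_of_one_le_right (by positivity) hL1
      have f4 : 2 * C₅ * (2 * Cδ / B.hmin * (2 * (1 + lg)) + 2 * π) ≤ 2 * C₅ * (2 * Cδ / B.hmin * (2 * L) + 2 * π * L) :=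
        mul_le_mul_of_nonneg_left (add_le_add f2 f3) (by positivity)
      have e : (2 * π * (2 * (2 * Cδ / ηo) + 1) + 2 * C₅ * (2 * Cδ / B.hmin * 2 + 2 * π)) * L =
          2 * π * (2 * (2 * Cδ / ηo) + 1) * L + 2 * C₅ * (2 * Cδ / B.hmin * (2 * L) + 2 * π * L) := by ring
      rw [e]; linarith only [f1, f4]
    calc 2 * π / w * (2 * (2 * Cδ / ηo) + 1) + 2 * C₅ * (2 * Cδ / B.hmin * (2 * (1 + lg)) / w + 2 * π / w)
        = (2 * π * (2 * (2 * Cδ / ηo) + 1) + 2 * C₅ * (2 * Cδ / B.hmin * (2 * (1 + lg)) + 2 * π)) / w := by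
          field_simp
      _ ≤ (2 * π * (2 * (2 * Cδ / ηo) + 1) + 2 * C₅ * (2 * Cδ / B.hmin * 2 + 2 * π)) * L / w :=
          div_le_div_of_nonneg_right key hw.le
  have heven' : N + 2 * EE ≤ (2 * π + 2 * (F₅ * (2 * (Kdy + 8 * π)))) * L / w := by
    rw [hNw]
    have t : 2 * π / w ≤ 2 * π * L / w := by
      apply div_le_div_of_nonneg_right _ hw.le; nlinarith only [hL1, hπ]
    have e : (2 * π + 2 * (F₅ * (2 * (Kdy + 8 * π)))) * L / w = 2 * π * L / w + 2 * (F₅ * (2 * (Kdy + 8 * π)) * L / w) := by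
      ring
    rw [e]; linarith only [t, hEB]
  have htrans' : 2 * (N * C₃') ≤ 4 * π * C₃' * L / w := by
    rw [hNw]
    have e : 2 * (2 * π / w * C₃') = 4 * π * C₃' / w := by field_simp; ring
    rw [e]
    apply div_le_div_of_nonneg_right _ hw.le
    exact le_mul_of_one_le_right (by positivity) hL1
  -- combine
  have h0 : (P₀.card : ℝ) ≤ (2 * π + 2 * (F₅ * (2 * (Kdy + 8 * π)))) * L / w +
      (2 * π * (2 * (2 * Cδ / ηo) + 1) + 2 * C₅ * (2 * Cδ / B.hmin * 2 + 2 * π)) * L / w := by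
    have := hP₀.trans hsplit
    linarith only [this, hA', hC', heven', hodd', hEB]
  have e : (4 * π * C₃' + (2 * π + 2 * (F₅ * (2 * (Kdy + 8 * π)))) +
      (2 * π * (2 * (2 * Cδ / ηo) + 1) + 2 * C₅ * (2 * Cδ / B.hmin * 2 + 2 * π))) * L / w =
      4 * π * C₃' * L / w + ((2 * π + 2 * (F₅ * (2 * (Kdy + 8 * π)))) * L / w +
      (2 * π * (2 * (2 * Cδ / ηo) + 1) + 2 * C₅ * (2 * Cδ / B.hmin * 2 + 2 * π)) * L / w) := by ring
  rw [e]
  linarith only [hcardP, hP₃, hP₂, htrans', h0]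

end Assembly


/-! ## From sector triples to pairs -/

/-- **Elimination of the third index**: if every `(i, c)`-fibre of a property of triples has at
most `C₀` elements and a non-empty fibre forces `R i c`, then the number of triples is at most
`C₀ · #{R}`. [folklore] -/
theorem card_prod3_le {N : ℕ} (Q : ℕ → ℕ → ℕ → Prop) (R : ℕ → ℕ → Prop)
    [DecidablePred fun ω : Fin N × Fin N × Fin N => Q ω.1 ω.2.1 ω.2.2]
    [∀ i c, DecidablePred (Q i c)] [DecidablePred fun p : ℕ × ℕ => R p.1 p.2] {C₀ : ℝ} (hC₀ : 0 ≤ C₀)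
    (hfib : ∀ i c, i < N → c < N → ((((Finset.range N).filter fun d => Q i c d).card : ℝ)) ≤ C₀)
    (himp : ∀ i c d, i < N → c < N → d < N → Q i c d → R i c) :
    (((Finset.univ.filter fun ω : Fin N × Fin N × Fin N => Q ω.1 ω.2.1 ω.2.2).card : ℝ)) ≤
      C₀ * ((((Finset.range N ×ˢ Finset.range N).filter fun p : ℕ × ℕ => R p.1 p.2).card : ℝ)) := by
  classical
  have hL : (((Finset.univ.filter fun ω : Fin N × Fin N × Fin N => Q ω.1 ω.2.1 ω.2.2).card : ℝ)) =
      ∑ i ∈ Finset.range N, ∑ c ∈ Finset.range N, ((((Finset.range N).filter fun d => Q i c d).card : ℝ)) := by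
    rw [Finset.natCast_card_filter, Fintype.sum_prod_type]
    rw [Fin.sum_univ_eq_sum_range (f := fun i : ℕ => ∑ q : Fin N × Fin N, if Q i q.1 q.2 then (1:ℝ) else 0)]
    refine Finset.sum_congr rfl fun i _ => ?_
    rw [Fintype.sum_prod_type]
    rw [Fin.sum_univ_eq_sum_range (f := fun c : ℕ => ∑ d : Fin N, if Q i c d then (1:ℝ) else 0)]
    refine Finset.sum_congr rfl fun c _ => ?_
    rw [Fin.sum_univ_eq_sum_range (f := fun d : ℕ => if Q i c d then (1:ℝ) else 0), Finset.natCast_card_filter]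
  have hR : ((((Finset.range N ×ˢ Finset.range N).filter fun p : ℕ × ℕ => R p.1 p.2).card : ℝ)) =
      ∑ i ∈ Finset.range N, ∑ c ∈ Finset.range N, (if R i c then (1:ℝ) else 0) := by
    rw [Finset.natCast_card_filter, Finset.sum_product]
    exact Finset.sum_congr rfl fun i _ => Finset.sum_congr rfl fun c _ => by by_cases h : R i c <;> simp [h]
  rw [hL, hR, Finset.mul_sum]
  refine Finset.sum_le_sum fun i hi => ?_
  rw [Finset.mul_sum]
  refine Finset.sum_le_sum fun c hc => ?_
  rw [Finset.mem_range] at hi hc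
  by_cases h0 : ((Finset.range N).filter fun d => Q i c d).card = 0
  · rw [h0]; push_cast; split_ifs <;> nlinarith
  · obtain ⟨d, hd⟩ := Finset.card_pos.1 (Nat.pos_of_ne_zero h0)
    rw [Finset.mem_filter, Finset.mem_range] at hd
    rw [if_pos (himp i c d hi hc hd.1 hd.2), mul_one]
    exact hfib i c hi hc


/-! ## Choice of the small constants -/

/-- **The small constants** `τ, λ, η_o, η₀, η₁` satisfying every smallness condition of the
covering, Cooper, fold and diagonal lemmas, in terms of the uniform bounds `B` and a level margin
`m₀`. [folklore] -/
theorem exists_small_constants {a b : ℝ} (B : BandBounds a b) {m₀ : ℝ} (hm₀ : 0 < m₀) :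
    ∃ τ lam ηo η₀ η₁ : ℝ, 0 < τ ∧ τ < π ∧ 0 < lam ∧ 0 < ηo ∧ 0 < η₀ ∧ η₀ ≤ m₀ ∧ 0 < η₁ ∧
      2 * (B.Cg * (lam / 2 + 2 * B.smax * (η₀ / B.Dtmin))) ≤ τ ∧
      4 * B.A2 * B.smax * (2 * τ + 2 * B.Cg * B.smax ^ 2 * τ + B.Cg * (ηo / 2)) ≤ B.hmin ∧
      2 * B.A2 * (η₀ / B.Dtmin + B.smax * (B.Cg * (lam + B.A2 * τ + 2 * B.smax * (η₀ / B.Dtmin)) + τ / 2)) ≤ B.hmin / 2 ∧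
      (16 * B.smax ^ 2 + 8 * B.A2) * (η₀ / B.Dtmin + B.smax * (B.Cg * (η₁ / 4 + 2 * B.smax * (η₀ / B.Dtmin)))) ≤ 2 * B.hmin := by
  have hA := B.A2_pos; have hs := B.smax_pos; have hh := B.hmin_pos; have hCg := B.Cg_pos; have hDt := B.Dtmin_pos
  have hπ := Real.pi_pos
  set A := B.A2; set s := B.smax; set h := B.hmin; set Cg := B.Cg; set Dt := B.Dtmin
  -- τ
  set τ := min (1 / 2) (min (h / (16 * A * s * (1 + Cg * s ^ 2))) (h / (16 * A * s * (Cg * A + 1)))) with hτ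
  have hτ0 : 0 < τ := lt_min (by norm_num) (lt_min (by positivity) (by positivity))
  have hτ1 : τ ≤ 1 / 2 := min_le_left _ _
  have hτa : τ ≤ h / (16 * A * s * (1 + Cg * s ^ 2)) := (min_le_right _ _).trans (min_le_left _ _)
  have hτb : τ ≤ h / (16 * A * s * (Cg * A + 1)) := (min_le_right _ _).trans (min_le_right _ _)
  -- ηo, λ, η₁
  set ηo := h / (4 * A * s * Cg) with hηo
  have hηo0 : 0 < ηo := by positivity
  set lam := min (τ / (2 * Cg)) (h / (16 * A * s * Cg)) with hlam
  have hlam0 : 0 < lam := lt_min (by positivity) (by positivity)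
  have hlam1 : lam ≤ τ / (2 * Cg) := min_le_left _ _
  have hlam2 : lam ≤ h / (16 * A * s * Cg) := min_le_right _ _
  set η₁ := 4 * h / ((16 * s ^ 2 + 8 * A) * s * Cg) with hη₁
  have hη₁0 : 0 < η₁ := by positivity
  -- η₀
  set η₀ := min m₀ (min (τ * Dt / (8 * Cg * s)) (min (h * Dt / (16 * A * (1 + 2 * s ^ 2 * Cg)))
    (h * Dt / ((16 * s ^ 2 + 8 * A) * (1 + 2 * s ^ 2 * Cg))))) with hη₀
  have hη₀0 : 0 < η₀ := lt_min hm₀ (lt_min (by positivity) (lt_min (by positivity) (by positivity)))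
  have hη₀m : η₀ ≤ m₀ := min_le_left _ _
  have hη₀a : η₀ ≤ τ * Dt / (8 * Cg * s) := (min_le_right _ _).trans (min_le_left _ _)
  have hη₀b : η₀ ≤ h * Dt / (16 * A * (1 + 2 * s ^ 2 * Cg)) :=
    (min_le_right _ _).trans ((min_le_right _ _).trans (min_le_left _ _))
  have hη₀c : η₀ ≤ h * Dt / ((16 * s ^ 2 + 8 * A) * (1 + 2 * s ^ 2 * Cg)) :=
    (min_le_right _ _).trans ((min_le_right _ _).trans (min_le_right _ _))
  refine ⟨τ, lam, ηo, η₀, η₁, hτ0, by linarith [Real.pi_gt_three], hlam0, hηo0, hη₀0, hη₀m, hη₁0, ?_, ?_, ?_, ?_⟩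
  · -- covering
    have e1 : Cg * lam ≤ τ / 2 := by
      calc Cg * lam ≤ Cg * (τ / (2 * Cg)) := mul_le_mul_of_nonneg_left hlam1 hCg.le
        _ = τ / 2 := by field_simp
    have e2 : 4 * Cg * s * η₀ / Dt ≤ τ / 2 := by
      calc 4 * Cg * s * η₀ / Dt ≤ 4 * Cg * s * (τ * Dt / (8 * Cg * s)) / Dt := by gcongr
        _ = τ / 2 := by field_simp; ring
    have : 2 * (Cg * (lam / 2 + 2 * s * (η₀ / Dt))) = Cg * lam + 4 * Cg * s * η₀ / Dt := by ring
    rw [this]; linarith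
  · -- Cooper
    have e1 : 8 * A * s * (1 + Cg * s ^ 2) * τ ≤ h / 2 := by
      calc 8 * A * s * (1 + Cg * s ^ 2) * τ ≤ 8 * A * s * (1 + Cg * s ^ 2) * (h / (16 * A * s * (1 + Cg * s ^ 2))) :=
            mul_le_mul_of_nonneg_left hτa (by positivity)
        _ = h / 2 := by field_simp; ring
    have e2 : 2 * A * s * Cg * ηo = h / 2 := by rw [hηo]; field_simp; ring
    have : 4 * A * s * (2 * τ + 2 * Cg * s ^ 2 * τ + Cg * (ηo / 2)) = 8 * A * s * (1 + Cg * s ^ 2) * τ + 2 * A * s * Cg * ηo := by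
      ring
    rw [this]; linarith
  · -- fold
    have e1 : 2 * A * (1 + 2 * s ^ 2 * Cg) * η₀ / Dt ≤ h / 8 := by
      calc 2 * A * (1 + 2 * s ^ 2 * Cg) * η₀ / Dt ≤ 2 * A * (1 + 2 * s ^ 2 * Cg) * (h * Dt / (16 * A * (1 + 2 * s ^ 2 * Cg))) / Dt := by
            gcongr
        _ = h / 8 := by field_simp; ring
    have e2 : 2 * A * s * Cg * lam ≤ h / 8 := by
      calc 2 * A * s * Cg * lam ≤ 2 * A * s * Cg * (h / (16 * A * s * Cg)) := mul_le_mul_of_nonneg_left hlam2 (by positivity)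
        _ = h / 8 := by field_simp; ring
    have e3 : A * s * (2 * Cg * A + 1) * τ ≤ h / 8 := by
      calc A * s * (2 * Cg * A + 1) * τ ≤ A * s * (2 * Cg * A + 1) * (h / (16 * A * s * (Cg * A + 1))) :=
            mul_le_mul_of_nonneg_left hτb (by positivity)
        _ = h * (2 * Cg * A + 1) / (16 * (Cg * A + 1)) := by field_simp
        _ ≤ h * (2 * (Cg * A + 1)) / (16 * (Cg * A + 1)) := by gcongr; linarith
        _ = h / 8 := by field_simp; ring
    have : 2 * A * (η₀ / Dt + s * (Cg * (lam + A * τ + 2 * s * (η₀ / Dt)) + τ / 2)) =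
        2 * A * (1 + 2 * s ^ 2 * Cg) * η₀ / Dt + 2 * A * s * Cg * lam + A * s * (2 * Cg * A + 1) * τ := by ring
    rw [this]; linarith
  · -- diagonal
    have e1 : (16 * s ^ 2 + 8 * A) * (1 + 2 * s ^ 2 * Cg) * η₀ / Dt ≤ h := by
      calc (16 * s ^ 2 + 8 * A) * (1 + 2 * s ^ 2 * Cg) * η₀ / Dt ≤
          (16 * s ^ 2 + 8 * A) * (1 + 2 * s ^ 2 * Cg) * (h * Dt / ((16 * s ^ 2 + 8 * A) * (1 + 2 * s ^ 2 * Cg))) / Dt := by gcongr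
        _ = h := by field_simp
    have e2 : (16 * s ^ 2 + 8 * A) * s * Cg * η₁ / 4 = h := by rw [hη₁]; field_simp
    have : (16 * s ^ 2 + 8 * A) * (η₀ / Dt + s * (Cg * (η₁ / 4 + 2 * s * (η₀ / Dt)))) =
        (16 * s ^ 2 + 8 * A) * (1 + 2 * s ^ 2 * Cg) * η₀ / Dt + (16 * s ^ 2 + 8 * A) * s * Cg * η₁ / 4 := by ring
    rw [this]; linarith

/-- `log (2·2ⁿ) ≤ n + 1`. [folklore] -/
theorem log_two_mul_two_pow_le (n : ℕ) : Real.log (2 * (2 : ℝ) ^ n) ≤ (n : ℝ) + 1 := by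
  rw [show (2 : ℝ) * 2 ^ n = 2 ^ (n + 1) by ring, Real.log_pow]
  have := Real.log_two_lt_d9
  have h0 : (0 : ℝ) ≤ n + 1 := by positivity
  push_cast
  nlinarith

/-- The sector centre in the form `w/2 + ω w`. [folklore] -/
theorem sectorCenter_eq (n ω : ℕ) : sectorCenter n ω = sectorWidth n / 2 + ω * sectorWidth n := by
  unfold sectorCenter; ring

end Literature.MathematicalPhysics.QuantumLattice.BandSectorCounting

end
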